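import Literature.NumberTheory.GaloisRepresentations.AdequacyDegreeTwo
import HarnessLib

/-!
# Primitive linear groups of prime degree are almost quasisimple (GHT 2017, Prop. 6.5 (ii))

Topic `NumberTheory/GaloisRepresentations`; a sibling of `AdequacyDegreeP.lean` (the named fact
`ght2017_adequate_or_index_p_or_psl29` = Guralnick–Herzig–Tiep 2017, Thm 1.7, with the reductions
`…_of_isAlgClosed`, `…_of_primitive` and the imprimitive branch Prop. 6.6 proved) and of
`AdequacyDegreeTwo.lean` (the case `p = 2` proved; `…_of_primitive_odd`).  This file PROVES,
without the classification of finite simple groups, the STRUCTURAL HALF of GHT Proposition 6.5 (ii)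
— the first step of the printed proof of Theorem 6.15 in the primitive case:

> Proposition 6.5. Let `k` be an algebraically closed field of characteristic `p` and let
> `G < GL_p(k)` be a finite irreducible subgroup. Then one of the following holds: (i) `G` is
> imprimitive …, and `A := G ∩ GL₁(k)ᵖ` is non-central in `G`; (ii) `G` is almost quasisimple.
> Furthermore, `H := G^(∞)` is quasisimple of order divisible by `p` acting irreducibly on `W`,
> and so `(H, W)` is as described in Theorem 2.2.

GHT prove (ii) by Aschbacher's theorem in the version of [GT3] (and [Zie], Zieschang's theorem on
transitive groups of prime degree, for the centrally-imprimitive sub-case); the identification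
"`(H, W)` as in Theorem 2.2" is the classification of finite simple groups.  Here:

* `Subgroup.exists_quasisimple_normal_of_primitive` — for `K = K̄` of characteristic `p`, a finite
  irreducible `H ≤ GL_p(K)` all of whose line-permutation structures have central kernel (exactly
  the hypothesis left over by `ght2017_adequate_or_index_p_or_psl29_of_primitive`) normalises some
  `L ≤ H` which is irreducible on `Kᵖ`, perfect, with `L/Z(L)` simple (non-abelian): the
  quasisimple layer of `H`; `C_H(L) = Z(H)` are the scalars of `H` (Schur), so
  `H/Z(H) ≤ Aut(L/Z(L))` — "`G` is almost quasisimple".  (That `L = G^(∞)` would need Schreier's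
  conjecture and is not claimed; `p ∣ |L|` is elementary — averaging and Schur, section
  `CharDvdCard` / `Subgroup.dvd_card_of_isIrreducible` below.)
* `not_exists_comm_normal_index_of_primitive` — for such groups alternative (b) of Theorem 1.7
  (an abelian normal subgroup of index `p`) does not occur.
* `ght2017_adequate_or_index_p_or_psl29_of_quasisimple_odd` — the sharpened reduction of the
  named fact: it follows from "(a) or (c)" for ODD `p`, `p ∣ |G|`, `τ` primitive, GIVEN the
  quasisimple layer `L` — i.e. from exactly GHT Theorem 2.2 (which `L/Z(L)` occur: CFSG) together
  with Props. 6.7–6.14 and Cor. 9.4–9.5 (the `Ext¹`-computations for each of them).  That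
  hypothesis is NOT in the tree.

## The proof (namespace `PrimeDegreeClifford`; elementary Clifford theory in prime degree)

1. Schur (`K = K̄`): a matrix commuting with an irreducible group is scalar (an eigenspace is
   stable); the centre of an irreducible group is scalar; no abelian group is irreducible in prime
   degree `p ≥ 2` (Mathlib `Representation.IsIrreducible.finrank_eq_one_of_isMulCommutative`).
2. `clifford` (any field): for `N` normalised by the finite irreducible `H ≤ GL_p(K)`, either `N`
   is irreducible, or `N` is scalar, or `Kᵖ` has a basis of common eigenvectors of `N` with
   pairwise distinct characters whose lines `H` permutes.  (A minimal non-zero `N`-stable `W₁`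
   inside a proper `N`-stable subspace; its translates `hW₁` are minimal `N`-stable, and a greedy
   sub-family is independent with the same — `H`-stable, hence total — span, so `dim W₁ ∣ p`,
   `dim W₁ = 1` (`exists_eigenbasis_of_minimal`); with distinct characters a common eigenvector
   lies on a coordinate line (`exists_eq_smul_basis_of_eigenvector`, `perm_of_distinct`); a
   coincidence of two characters forces all to coincide: the joint eigenspaces of the conjugate
   characters are coordinate blocks of one size `e ≥ 2`, permuted by `H`, covering, pairwise equal
   or disjoint, so `e ∣ p` (`scalar_of_coincidence`, `dvd_card_of_blocks`).)
3. `eq_bot_or_card_eq_of_comm_of_transitive`: an abelian subgroup of `S_p` normalised by a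
   transitive one is trivial or of order `p` (orbits of equal size; regularity).
4. `false_of_lines_of_normal`: in a primitive `H`, no `H`-normalised irreducible `L` has a line
   structure `(b, θ)` with a non-scalar kernel element.  (`A := ker`, diagonal along `b`, abelian, a
   `p'`-group by `MonomialAdequacy.not_dvd_card_ker`.  For `h ∈ H`, Clifford for `A ∩ hAh⁻¹ ⊴ L`:
   irreducible is impossible, "lines" makes both `b i` and `h b i` common eigenvectors with distinct
   characters, so `h` permutes the lines of `b`; else `A ∩ hAh⁻¹` is scalar.  If every `h`
   permutes the lines, primitivity of `H` puts `A` in the centre: scalar.  Otherwise `θ(hAh⁻¹)` is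
   abelian and normal in the transitive `θ(L)`: trivial forces `hAh⁻¹ = A`, scalar; order `p`
   contradicts `p ∤ |A|`.)
5. `exists_quasisimple_normal_of_primitive`: `L` := an `H`-normalised non-scalar subgroup of `H`
   of least order.  `L` is irreducible (2 + primitivity + 1).  `⁅L, L⁆` is `H`-normalised, hence
   `= L` or scalar; if scalar, `⟨x, L ∩ Z⟩` (`x ∈ L` non-scalar) is abelian and `L`-normal, and
   Clifford + 4 give a contradiction: `L` is perfect.  For `M ⊴ L` (strong induction on `|M|`):
   scalar; or "lines" (impossible by 4); or irreducible, and then `M = L` — otherwise the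
   `H`-normalised core `M ∩ ⋂ₕ hMh⁻¹` is scalar by minimality, some `M ∩ hMh⁻¹ < M` is scalar by
   induction, so `y x y⁻¹ x⁻¹ = λ · 1` for `x ∈ M`, `y ∈ hMh⁻¹`, `det` gives `λᵖ = 1`, `λ = 1`
   (`commute_of_commutator_scalar`), `hMh⁻¹` centralises the irreducible `M` and is scalar, and so
   is `M`.  With `Z(L) = L ∩ Z` (Schur) this is the simplicity of `L/Z(L)`.

## References

* [GuralnickHerzigTiep2017] R. M. Guralnick, F. Herzig, P. H. Tiep, *Adequate subgroups and
  indecomposable modules*, J. Eur. Math. Soc. 19 (2017) 1231–1291 = arXiv:1405.0043,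
  Proposition 6.5 (arXiv p. 19), Theorem 6.15 and its proof (p. 24), Theorem 2.2 (p. 6–7).
* [Thorne2017TwoAdic] J. Thorne, Math. Z. 285 (2017), Def. 2.20 (the notion of adequacy).
-/

open scoped MatrixGroups Matrix

namespace Literature.NumberTheory.GaloisRepresentations

universe u v

namespace PrimeDegreeClifford

variable {K : Type u} [Field K]

/-! ### Schur-type lemmas for an irreducible matrix group over an algebraically closed field -/

section Schur

variable {n : ℕ}

/-- A stable subspace of an irreducible matrix group is `⊥` or `⊤`. [folklore] -/
theorem eq_bot_or_eq_top_of_stable {H : Subgroup (GL (Fin n) K)}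
    (hirr : (glRepresentation H.subtype).IsIrreducible) (W : Submodule K (Fin n → K))
    (hW : ∀ h ∈ H, ∀ v ∈ W, ((h : GL (Fin n) K) : Matrix (Fin n) (Fin n) K) *ᵥ v ∈ W) :
    W = ⊥ ∨ W = ⊤ := by
  let W' : Subrepresentation (glRepresentation H.subtype) := ⟨W, fun h v hv => hW h h.2 v hv⟩
  rcases @IsSimpleOrder.eq_bot_or_eq_top _ _ _ hirr W' with h0 | h1
  · exact Or.inl (congrArg Subrepresentation.toSubmodule h0)
  · exact Or.inr (congrArg Subrepresentation.toSubmodule h1)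

/-- An irreducible matrix group lives in positive dimension. [folklore] -/
theorem pos_of_isIrreducible {H : Subgroup (GL (Fin n) K)}
    (hirr : (glRepresentation H.subtype).IsIrreducible) : 0 < n := by
  rcases Nat.eq_zero_or_pos n with rfl | hn
  · exfalso
    haveI : Subsingleton (Fin 0 → K) := inferInstance
    haveI : Subsingleton (Subrepresentation (glRepresentation H.subtype)) :=
      Subrepresentation.toSubmodule_injective.subsingleton
    exact not_nontrivial _ hirr.toNontrivial
  · exact hn

/-- **Schur's lemma, matrix form.** A matrix commuting with an irreducible `H ≤ GL_n(K)`, `K`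
algebraically closed, is scalar: an eigenspace of it is a non-zero `H`-stable subspace. [folklore] -/
theorem exists_eq_smul_one_of_forall_commute [IsAlgClosed K] {H : Subgroup (GL (Fin n) K)}
    (hirr : (glRepresentation H.subtype).IsIrreducible) {M : Matrix (Fin n) (Fin n) K}
    (hM : ∀ h ∈ H, ((h : GL (Fin n) K) : Matrix (Fin n) (Fin n) K) * M = M * h) :
    ∃ c : K, M = c • (1 : Matrix (Fin n) (Fin n) K) := by
  have hn := pos_of_isIrreducible hirr
  haveI : Nontrivial (Fin n → K) := by
    refine ⟨⟨Pi.single ⟨0, hn⟩ 1, 0, ?_⟩⟩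
    intro h
    have := congrFun h ⟨0, hn⟩
    simp at this
  obtain ⟨μ, hμ⟩ := Module.End.exists_eigenvalue (Matrix.toLin' M)
  obtain ⟨v, hv⟩ := hμ.exists_hasEigenvector
  let E : Submodule K (Fin n → K) :=
    Module.End.eigenspace (Matrix.toLin' M : Module.End K (Fin n → K)) μ
  have hE : ∀ h ∈ H, ∀ w ∈ E, ((h : GL (Fin n) K) : Matrix (Fin n) (Fin n) K) *ᵥ w ∈ E := by
    intro h hh w hw
    rw [Module.End.mem_eigenspace_iff, Matrix.toLin'_apply] at hw ⊢
    rw [Matrix.mulVec_mulVec, ← hM h hh, ← Matrix.mulVec_mulVec, hw, Matrix.mulVec_smul]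
  rcases eq_bot_or_eq_top_of_stable hirr E hE with h0 | h1
  · exfalso
    have hvE : v ∈ E := hv.1
    rw [h0, Submodule.mem_bot] at hvE
    exact hv.2 hvE
  · refine ⟨μ, ?_⟩
    apply Matrix.toLin'.injective
    apply LinearMap.ext
    intro w
    have hw : w ∈ E := h1 ▸ Submodule.mem_top
    rw [Module.End.mem_eigenspace_iff] at hw
    rw [hw, map_smul, Matrix.toLin'_one, LinearMap.smul_apply, LinearMap.id_apply]

/-- The centre of an irreducible `H ≤ GL_n(K)` (`K = K̄`) consists of scalar matrices. [folklore] -/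
theorem exists_eq_smul_one_of_mem_center [IsAlgClosed K] {H : Subgroup (GL (Fin n) K)}
    (hirr : (glRepresentation H.subtype).IsIrreducible) {z : H} (hz : z ∈ Subgroup.center H) :
    ∃ c : K, ((z : GL (Fin n) K) : Matrix (Fin n) (Fin n) K) = c • (1 : Matrix (Fin n) (Fin n) K) := by
  refine exists_eq_smul_one_of_forall_commute hirr fun h hh => ?_
  have h1 := Subgroup.mem_center_iff.1 hz ⟨h, hh⟩
  have h2 := congrArg (fun x : H => ((x : GL (Fin n) K) : Matrix (Fin n) (Fin n) K)) h1
  simpa only [Subgroup.coe_mul, Units.val_mul] using h2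

/-- An irreducible abelian matrix group over `K = K̄` lives in dimension `1`; in particular there is
no irreducible abelian `A ≤ GL_p(K)` for `p` prime. [folklore] -/
theorem not_isIrreducible_of_comm [IsAlgClosed K] {p : ℕ} [hp : Fact p.Prime]
    {A : Subgroup (GL (Fin p) K)} (hcomm : ∀ x ∈ A, ∀ y ∈ A, x * y = y * x)
    (hirr : (glRepresentation A.subtype).IsIrreducible) : False := by
  haveI : IsMulCommutative A := ⟨⟨fun a b => Subtype.ext (hcomm a a.2 b b.2)⟩⟩
  haveI : (glRepresentation A.subtype).IsIrreducible := hirr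
  have h1 := Representation.IsIrreducible.finrank_eq_one_of_isMulCommutative
    (glRepresentation A.subtype)
  rw [Module.finrank_fin_fun] at h1
  exact hp.out.one_lt.ne' h1

/-- An irreducible `H ≤ GL_p(K)`, `p` prime, contains a non-scalar matrix (otherwise every line is
stable). [folklore] -/
theorem exists_not_scalar_of_isIrreducible {p : ℕ} [hp : Fact p.Prime] {H : Subgroup (GL (Fin p) K)}
    (hirr : (glRepresentation H.subtype).IsIrreducible) :
    ∃ x ∈ H, ∀ c : K, ((x : GL (Fin p) K) : Matrix (Fin p) (Fin p) K) ≠ c • 1 := by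
  by_contra hcon
  push Not at hcon
  have h0 : 0 < p := hp.out.pos
  let W : Submodule K (Fin p → K) := K ∙ Pi.single ⟨0, h0⟩ 1
  have hW : ∀ h ∈ H, ∀ v ∈ W, ((h : GL (Fin p) K) : Matrix (Fin p) (Fin p) K) *ᵥ v ∈ W := by
    intro h hh v hv
    obtain ⟨c, hc⟩ := hcon h hh
    rw [hc, Matrix.smul_mulVec, Matrix.one_mulVec]
    exact W.smul_mem c hv
  rcases eq_bot_or_eq_top_of_stable hirr W hW with hb | ht
  · have hmem : (Pi.single ⟨0, h0⟩ 1 : Fin p → K) ∈ W := Submodule.mem_span_singleton_self _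
    rw [hb, Submodule.mem_bot] at hmem
    exact (one_ne_zero (α := K)) (by simpa using congrFun hmem ⟨0, h0⟩)
  · have hmem : (Pi.single ⟨1, hp.out.one_lt⟩ 1 : Fin p → K) ∈ W := ht ▸ Submodule.mem_top
    rw [Submodule.mem_span_singleton] at hmem
    obtain ⟨a, ha⟩ := hmem
    have := congrFun ha ⟨1, hp.out.one_lt⟩
    simp [Fin.ext_iff] at this

end Schur

/-! ### A counting lemma: equal-sized blocks that cover and pairwise coincide or are disjoint -/

/-- If a finite type is covered by blocks `C i` of common size `s`, any two of which coincide or are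
disjoint, then `s` divides its cardinality. [folklore] -/
theorem dvd_card_of_blocks {α ι : Type*} [Fintype α] [DecidableEq α] [Fintype ι]
    (C : ι → Finset α) (s : ℕ) (hcard : ∀ i, (C i).card = s)
    (hdisj : ∀ i j, C i = C j ∨ Disjoint (C i) (C j)) (hcov : ∀ a, ∃ i, a ∈ C i) :
    s ∣ Fintype.card α := by
  classical
  let P : Finset (Finset α) := Finset.univ.image C
  have hU : (Finset.univ : Finset α) = P.biUnion id := by
    ext a
    simp only [Finset.mem_univ, Finset.mem_biUnion, Finset.mem_image, true_and, id, true_iff, P]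
    obtain ⟨i, hi⟩ := hcov a
    exact ⟨C i, ⟨i, rfl⟩, hi⟩
  have hPd : (P : Set (Finset α)).PairwiseDisjoint id := by
    intro c hc c' hc' hne
    simp only [Finset.coe_image, Finset.coe_univ, Set.image_univ, Set.mem_range, P] at hc hc'
    obtain ⟨i, rfl⟩ := hc
    obtain ⟨j, rfl⟩ := hc'
    rcases hdisj i j with h | h
    · exact absurd h hne
    · exact h
  have h1 : Fintype.card α = ∑ c ∈ P, c.card := by
    rw [← Finset.card_univ, hU, Finset.card_biUnion hPd]
    rfl
  have h2 : ∑ c ∈ P, c.card = ∑ _c ∈ P, s := by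
    refine Finset.sum_congr rfl fun c hc => ?_
    simp only [Finset.mem_image, Finset.mem_univ, true_and, P] at hc
    obtain ⟨i, rfl⟩ := hc
    exact hcard i
  rw [h1, h2, Finset.sum_const, smul_eq_mul]
  exact Dvd.intro_left _ rfl

/-! ### Extraction of a direct sum from a family of subspaces with the dichotomy property -/

/-- If each `X i` is either contained in, or meets trivially, any finite sup of the others, then some
subfamily has the same sup and its dimension is the sum of the dimensions. [folklore] -/
theorem exists_subfamily_finrank_eq {V : Type*} [AddCommGroup V] [Module K V]
    [FiniteDimensional K V] {ι : Type*} [DecidableEq ι] (X : ι → Submodule K V)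
    (hX : ∀ (i : ι) (t : Finset ι), X i ≤ (⨆ j ∈ t, X j) ∨ X i ⊓ (⨆ j ∈ t, X j) = ⊥)
    (s : Finset ι) :
    ∃ t ⊆ s, (⨆ j ∈ t, X j) = (⨆ j ∈ s, X j) ∧
      Module.finrank K ↥(⨆ j ∈ t, X j) = ∑ j ∈ t, Module.finrank K (X j) := by
  induction s using Finset.induction_on with
  | empty => exact ⟨∅, Finset.Subset.refl _, rfl, by simp⟩
  | @insert a s ha ih =>
    obtain ⟨t, hts, hsup, hrank⟩ := ih
    by_cases hle : X a ≤ ⨆ j ∈ t, X j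
    · refine ⟨t, hts.trans (Finset.subset_insert a s), ?_, hrank⟩
      rw [Finset.iSup_insert, ← hsup]
      exact (sup_eq_right.2 hle).symm
    · have hbot : X a ⊓ (⨆ j ∈ t, X j) = ⊥ := (hX a t).resolve_left hle
      have hat : a ∉ t := fun h => ha (hts h)
      refine ⟨insert a t, Finset.insert_subset_insert a hts, ?_, ?_⟩
      · rw [Finset.iSup_insert, Finset.iSup_insert, hsup]
      · rw [Finset.iSup_insert, Finset.sum_insert hat, ← hrank]
        have h := Submodule.finrank_sup_add_finrank_inf_eq (X a) (⨆ j ∈ t, X j)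
        rw [hbot, finrank_bot, add_zero] at h
        exact h

/-! ### Stable subspaces: translates, sups, coordinates -/

section Stable

variable {n : ℕ}


/-- `v ↦ g v` is injective for `g ∈ GL_n`. [folklore] -/
theorem toLin'_units_injective (g : GL (Fin n) K) :
    Function.Injective (Matrix.toLin' ((g : GL (Fin n) K) : Matrix (Fin n) (Fin n) K)) := by
  intro v w hvw
  simp only [Matrix.toLin'_apply] at hvw
  have h := congrArg (fun u => ((g⁻¹ : GL (Fin n) K) : Matrix (Fin n) (Fin n) K) *ᵥ u) hvw
  simpa only [Matrix.mulVec_mulVec, ← Units.val_mul, inv_mul_cancel, Units.val_one,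
    Matrix.one_mulVec] using h

/-- Translating a subspace by `g ∈ GL_n` does not change its dimension. [folklore] -/
theorem finrank_map_units (g : GL (Fin n) K) (W : Submodule K (Fin n → K)) :
    Module.finrank K ↥(W.map (Matrix.toLin' ((g : GL (Fin n) K) : Matrix (Fin n) (Fin n) K))) = Module.finrank K W :=
  (Submodule.equivMapOfInjective _ (toLin'_units_injective g) W).finrank_eq.symm

/-- `g⁻¹ (g W) = W`. [folklore] -/
theorem map_map_inv_units (g : GL (Fin n) K) (W : Submodule K (Fin n → K)) :
    (W.map (Matrix.toLin' ((g : GL (Fin n) K) : Matrix (Fin n) (Fin n) K))).map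
      (Matrix.toLin' ((g⁻¹ : GL (Fin n) K) : Matrix (Fin n) (Fin n) K)) = W := by
  rw [← Submodule.map_comp, ← Matrix.toLin'_mul, ← Units.val_mul, inv_mul_cancel, Units.val_one,
    Matrix.toLin'_one, Submodule.map_id]

/-- `g (g⁻¹ W) = W`. [folklore] -/
theorem map_inv_map_units (g : GL (Fin n) K) (W : Submodule K (Fin n → K)) :
    (W.map (Matrix.toLin' ((g⁻¹ : GL (Fin n) K) : Matrix (Fin n) (Fin n) K))).map
      (Matrix.toLin' ((g : GL (Fin n) K) : Matrix (Fin n) (Fin n) K)) = W := by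
  rw [← Submodule.map_comp, ← Matrix.toLin'_mul, ← Units.val_mul, mul_inv_cancel, Units.val_one,
    Matrix.toLin'_one, Submodule.map_id]

/-- If `N` stabilises `W` and `g` normalises `N`, then `N` stabilises `g W`. [folklore] -/
theorem stable_map_of_normal {N : Subgroup (GL (Fin n) K)} {W : Submodule K (Fin n → K)}
    (hW : ∀ x ∈ N, ∀ v ∈ W, ((x : GL (Fin n) K) : Matrix (Fin n) (Fin n) K) *ᵥ v ∈ W) (g : GL (Fin n) K)
    (hg : ∀ x ∈ N, g⁻¹ * x * g ∈ N) :
    ∀ x ∈ N, ∀ v ∈ W.map (Matrix.toLin' ((g : GL (Fin n) K) : Matrix (Fin n) (Fin n) K)),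
      ((x : GL (Fin n) K) : Matrix (Fin n) (Fin n) K) *ᵥ v ∈ W.map (Matrix.toLin' ((g : GL (Fin n) K) : Matrix (Fin n) (Fin n) K)) := by
  intro x hx v hv
  rw [Submodule.mem_map] at hv ⊢
  obtain ⟨w, hw, rfl⟩ := hv
  refine ⟨((g⁻¹ * x * g : GL (Fin n) K) : Matrix (Fin n) (Fin n) K) *ᵥ w, hW _ (hg x hx) w hw, ?_⟩
  have hgx : (g : GL (Fin n) K) * (g⁻¹ * x * g) = x * g := by group
  rw [Matrix.toLin'_apply, Matrix.toLin'_apply, Matrix.mulVec_mulVec, Matrix.mulVec_mulVec,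
    ← Units.val_mul, hgx, Units.val_mul]

/-- A finite sup of `N`-stable subspaces is `N`-stable. [folklore] -/
theorem stable_biSup {N : Subgroup (GL (Fin n) K)} {ι : Type*} (t : Finset ι)
    (X : ι → Submodule K (Fin n → K))
    (hX : ∀ j ∈ t, ∀ x ∈ N, ∀ v ∈ X j, ((x : GL (Fin n) K) : Matrix (Fin n) (Fin n) K) *ᵥ v ∈ X j) :
    ∀ x ∈ N, ∀ v ∈ (⨆ j ∈ t, X j), ((x : GL (Fin n) K) : Matrix (Fin n) (Fin n) K) *ᵥ v ∈ (⨆ j ∈ t, X j) := by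
  intro x hx v hv
  have hle : (⨆ j ∈ t, X j) ≤ (⨆ j ∈ t, X j).comap (Matrix.toLin' ((x : GL (Fin n) K) : Matrix (Fin n) (Fin n) K)) := by
    refine iSup₂_le fun j hj => ?_
    refine le_trans ?_ (Submodule.comap_mono (le_iSup₂ (f := fun j _ => X j) j hj))
    intro w hw
    rw [Submodule.mem_comap, Matrix.toLin'_apply]
    exact hX j hj x hx w hw
  have := hle hv
  rwa [Submodule.mem_comap, Matrix.toLin'_apply] at this

/-- A sup over a finite index type of `N`-stable subspaces is `N`-stable. [folklore] -/
theorem stable_iSup {N : Subgroup (GL (Fin n) K)} {ι : Type*} [Finite ι]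
    (X : ι → Submodule K (Fin n → K))
    (hX : ∀ j, ∀ x ∈ N, ∀ v ∈ X j, ((x : GL (Fin n) K) : Matrix (Fin n) (Fin n) K) *ᵥ v ∈ X j) :
    ∀ x ∈ N, ∀ v ∈ (⨆ j, X j), ((x : GL (Fin n) K) : Matrix (Fin n) (Fin n) K) *ᵥ v ∈ (⨆ j, X j) := by
  intro x hx v hv
  have hle : (⨆ j, X j) ≤ (⨆ j, X j).comap (Matrix.toLin' ((x : GL (Fin n) K) : Matrix (Fin n) (Fin n) K)) := by
    refine iSup_le fun j => ?_
    refine le_trans ?_ (Submodule.comap_mono (le_iSup X j))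
    intro w hw
    rw [Submodule.mem_comap, Matrix.toLin'_apply]
    exact hX j x hx w hw
  have := hle hv
  rwa [Submodule.mem_comap, Matrix.toLin'_apply] at this

/-- Coordinates of `x • v` along a basis of `N`-eigenvectors with characters `χ`. [folklore] -/
theorem repr_mulVec_of_diag {N : Subgroup (GL (Fin n) K)} (b : Module.Basis (Fin n) K (Fin n → K))
    (χ : GL (Fin n) K → Fin n → K)
    (hdiag : ∀ x ∈ N, ∀ i, ((x : GL (Fin n) K) : Matrix (Fin n) (Fin n) K) *ᵥ b i = χ x i • b i)
    {x : GL (Fin n) K} (hx : x ∈ N) (v : Fin n → K) (i : Fin n) :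
    b.repr (((x : GL (Fin n) K) : Matrix (Fin n) (Fin n) K) *ᵥ v) i = b.repr v i * χ x i := by
  conv_lhs => rw [← b.sum_repr v]
  rw [Matrix.mulVec_sum]
  simp_rw [Matrix.mulVec_smul]
  have h1 : ∀ j, b.repr v j • (((x : GL (Fin n) K) : Matrix (Fin n) (Fin n) K) *ᵥ b j) = (b.repr v j * χ x j) • b j := by
    intro j
    rw [hdiag x hx j, smul_smul]
  simp_rw [h1]
  have h2 := b.repr_sum_self (fun j => b.repr v j * χ x j)
  exact congrFun h2 i

/-- **A common eigenvector of a diagonal group with pairwise distinct characters lies on one of the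
coordinate lines.** [folklore] -/
theorem exists_eq_smul_basis_of_eigenvector {N : Subgroup (GL (Fin n) K)}
    (b : Module.Basis (Fin n) K (Fin n → K)) (χ : GL (Fin n) K → Fin n → K)
    (hdiag : ∀ x ∈ N, ∀ i, ((x : GL (Fin n) K) : Matrix (Fin n) (Fin n) K) *ᵥ b i = χ x i • b i)
    (hdist : ∀ i j, i ≠ j → ∃ x ∈ N, χ x i ≠ χ x j)
    {w : Fin n → K} (hw : w ≠ 0) (heig : ∀ x ∈ N, ∃ c : K, ((x : GL (Fin n) K) : Matrix (Fin n) (Fin n) K) *ᵥ w = c • w) :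
    ∃ (j : Fin n) (c : K), w = c • b j := by
  classical
  -- two non-zero coordinates would see the same character
  have hone : ∀ j j', b.repr w j ≠ 0 → b.repr w j' ≠ 0 → j = j' := by
    intro j j' hj hj'
    by_contra hne
    obtain ⟨x, hx, hxne⟩ := hdist j j' hne
    obtain ⟨c, hc⟩ := heig x hx
    have ej := repr_mulVec_of_diag b χ hdiag hx w j
    have ej' := repr_mulVec_of_diag b χ hdiag hx w j'
    rw [hc, map_smul, Finsupp.smul_apply, smul_eq_mul, mul_comm] at ej ej'
    exact hxne ((mul_left_cancel₀ hj ej).symm.trans (mul_left_cancel₀ hj' ej'))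
  have hex : ∃ j, b.repr w j ≠ 0 := by
    by_contra hno
    push Not at hno
    apply hw
    have : b.repr w = 0 := Finsupp.ext fun j => hno j
    exact b.repr.map_eq_zero_iff.1 this
  obtain ⟨j, hj⟩ := hex
  refine ⟨j, b.repr w j, ?_⟩
  conv_lhs => rw [← b.sum_repr w]
  rw [Finset.sum_eq_single j]
  · intro j' _ hj'
    by_cases h0 : b.repr w j' = 0
    · rw [h0, zero_smul]
    · exact absurd (hone j' j h0 hj) hj'
  · intro h; exact absurd (Finset.mem_univ j) h

end Stable

/-! ### Clifford theory in prime degree -/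

section Clifford

variable {p : ℕ} [hp : Fact p.Prime]


/-- **Clifford's theorem in prime degree, the key count.**  Let `H ≤ GL_p(K)` be finite and
irreducible and let `N` be normalised by `H`.  If `W₁` is a proper, non-zero, `N`-stable subspace
which is minimal among the non-zero `N`-stable subspaces, then `W₁` is a line, and `Kᵖ` has a basis
of common eigenvectors of `N` (translates of `W₁` by elements of `H`).  Proof: the translates
`h W₁` are again minimal `N`-stable, so a sub-family of them is independent with the same (non-zero,
`H`-stable, hence total) span; thus `dim W₁ ∣ p`. [folklore] -/
theorem exists_eigenbasis_of_minimal {H N : Subgroup (GL (Fin p) K)} [Finite H]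
    (hirr : (glRepresentation H.subtype).IsIrreducible)
    (hnorm : ∀ h ∈ H, ∀ x ∈ N, h * x * h⁻¹ ∈ N)
    {W₁ : Submodule K (Fin p → K)} (hW₁ : W₁ ≠ ⊥) (hW₁top : W₁ ≠ ⊤)
    (hst : ∀ x ∈ N, ∀ v ∈ W₁, ((x : GL (Fin p) K) : Matrix (Fin p) (Fin p) K) *ᵥ v ∈ W₁)
    (hmin : ∀ W' : Submodule K (Fin p → K),
      (∀ x ∈ N, ∀ v ∈ W', ((x : GL (Fin p) K) : Matrix (Fin p) (Fin p) K) *ᵥ v ∈ W') → W' ≤ W₁ → W' = ⊥ ∨ W' = W₁) :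
    ∃ (b : Module.Basis (Fin p) K (Fin p → K)) (χ : GL (Fin p) K → Fin p → K),
      ∀ x ∈ N, ∀ i, ((x : GL (Fin p) K) : Matrix (Fin p) (Fin p) K) *ᵥ b i = χ x i • b i := by
  classical
  haveI : Fintype H := Fintype.ofFinite H
  have hnorm' : ∀ h ∈ H, ∀ x ∈ N, h⁻¹ * x * h ∈ N := fun h hh x hx => by
    simpa only [inv_inv] using hnorm h⁻¹ (H.inv_mem hh) x hx
  -- the translates of `W₁`
  let X : H → Submodule K (Fin p → K) := fun h =>
    W₁.map (Matrix.toLin' (((h : H) : GL (Fin p) K) : Matrix (Fin p) (Fin p) K))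
  have hXst : ∀ h, ∀ x ∈ N, ∀ v ∈ X h, ((x : GL (Fin p) K) : Matrix (Fin p) (Fin p) K) *ᵥ v ∈ X h := fun h =>
    stable_map_of_normal hst (h : GL (Fin p) K) (hnorm' _ h.2)
  have hXmin : ∀ (h : H) (W' : Submodule K (Fin p → K)),
      (∀ x ∈ N, ∀ v ∈ W', ((x : GL (Fin p) K) : Matrix (Fin p) (Fin p) K) *ᵥ v ∈ W') → W' ≤ X h →
      W' = ⊥ ∨ W' = X h := by
    intro h W' hW'st hW'le
    have hst' := stable_map_of_normal hW'st ((h : GL (Fin p) K)⁻¹) fun x hx => by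
      simpa only [inv_inv] using hnorm _ h.2 x hx
    have hle' : W'.map (Matrix.toLin' (((h : GL (Fin p) K)⁻¹ : GL (Fin p) K) : Matrix (Fin p) (Fin p) K)) ≤ W₁ := by
      calc W'.map (Matrix.toLin' (((h : GL (Fin p) K)⁻¹ : GL (Fin p) K) : Matrix (Fin p) (Fin p) K))
          ≤ (X h).map (Matrix.toLin' (((h : GL (Fin p) K)⁻¹ : GL (Fin p) K) : Matrix (Fin p) (Fin p) K)) :=
            Submodule.map_mono hW'le
        _ = W₁ := map_map_inv_units _ W₁
    rcases hmin _ hst' hle' with h0 | h1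
    · left
      rw [← map_inv_map_units (h : GL (Fin p) K) W', h0, Submodule.map_bot]
    · right
      rw [← map_inv_map_units (h : GL (Fin p) K) W', h1]
  -- dichotomy property of the translates
  have hX : ∀ (i : H) (t : Finset H), X i ≤ (⨆ j ∈ t, X j) ∨ X i ⊓ (⨆ j ∈ t, X j) = ⊥ := by
    intro i t
    have hUst := stable_biSup (N := N) t X fun j _ => hXst j
    have hinfst : ∀ x ∈ N, ∀ v ∈ X i ⊓ (⨆ j ∈ t, X j),
        ((x : GL (Fin p) K) : Matrix (Fin p) (Fin p) K) *ᵥ v ∈ X i ⊓ (⨆ j ∈ t, X j) :=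
      fun x hx v hv => ⟨hXst i x hx v hv.1, hUst x hx v hv.2⟩
    rcases hXmin i _ hinfst inf_le_left with h0 | h1
    · exact Or.inr h0
    · exact Or.inl (inf_eq_left.1 h1)
  obtain ⟨t, -, htsup, htrank⟩ := exists_subfamily_finrank_eq X hX Finset.univ
  -- the sup of all translates is `H`-stable and non-zero, hence everything
  have hU : (⨆ j ∈ (Finset.univ : Finset H), X j) = ⨆ j, X j := by simp
  have hUtop : (⨆ j, X j) = ⊤ := by
    have hUst : ∀ g ∈ H, ∀ v ∈ (⨆ j, X j), ((g : GL (Fin p) K) : Matrix (Fin p) (Fin p) K) *ᵥ v ∈ (⨆ j, X j) := by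
      intro g hg v hv
      have hle : (⨆ j, X j) ≤ (⨆ j, X j).comap (Matrix.toLin' ((g : GL (Fin p) K) : Matrix (Fin p) (Fin p) K)) := by
        refine iSup_le fun j => ?_
        intro w hw
        rw [Submodule.mem_comap]
        have hw' : Matrix.toLin' ((g : GL (Fin p) K) : Matrix (Fin p) (Fin p) K) w ∈ X (⟨g, hg⟩ * j) := by
          simp only [X]
          rw [Subgroup.coe_mul, Units.val_mul, Matrix.toLin'_mul, Submodule.map_comp]
          exact Submodule.mem_map_of_mem hw
        exact le_iSup X (⟨g, hg⟩ * j) hw'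
      have := hle hv
      rwa [Submodule.mem_comap, Matrix.toLin'_apply] at this
    rcases eq_bot_or_eq_top_of_stable hirr _ hUst with h0 | h1
    · exfalso
      apply hW₁
      have h1W : X 1 = W₁ := by
        simp only [X, Subgroup.coe_one, Units.val_one, Matrix.toLin'_one, Submodule.map_id]
      rw [eq_bot_iff, ← h0, ← h1W]
      exact le_iSup X 1
    · exact h1
  -- counting dimensions: `p = |t| · dim W₁`
  have hfr : ∀ j, Module.finrank K (X j) = Module.finrank K W₁ := fun j => finrank_map_units _ W₁
  rw [htsup, hU, hUtop, finrank_top, Module.finrank_fin_fun] at htrank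
  simp_rw [hfr] at htrank
  rw [Finset.sum_const, smul_eq_mul] at htrank
  have hd_dvd : Module.finrank K W₁ ∣ p := Dvd.intro_left _ htrank.symm
  have hd_lt : Module.finrank K W₁ < p := by
    simpa only [Module.finrank_fin_fun] using Submodule.finrank_lt hW₁top
  have hd1 : Module.finrank K W₁ = 1 := by
    rcases (Nat.dvd_prime hp.out).1 hd_dvd with h | h
    · exact h
    · exact absurd h hd_lt.ne
  rw [hd1, mul_one] at htrank
  -- `W₁ = K v`
  obtain ⟨v₁, hv₁0, hv₁⟩ := finrank_eq_one_iff'.1 hd1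
  have hv0 : (v₁ : Fin p → K) ≠ 0 := fun h => hv₁0 (Subtype.ext h)
  have hW₁v : ∀ w ∈ W₁, ∃ c : K, c • (v₁ : Fin p → K) = w := fun w hw => by
    obtain ⟨c, hc⟩ := hv₁ ⟨w, hw⟩
    exact ⟨c, by simpa using congrArg Subtype.val hc⟩
  -- the vectors `j v`, `j ∈ t`, span and are `p` in number: a basis
  let f : ↥t → (Fin p → K) := fun j => (((j : H) : GL (Fin p) K) : Matrix (Fin p) (Fin p) K) *ᵥ (v₁ : Fin p → K)
  have hspan : ⊤ ≤ Submodule.span K (Set.range f) := by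
    rw [← hUtop, ← hU, ← htsup]
    refine iSup₂_le fun j hj => ?_
    intro w hw
    simp only [X, Submodule.mem_map] at hw
    obtain ⟨w₀, hw₀, rfl⟩ := hw
    obtain ⟨c, rfl⟩ := hW₁v w₀ hw₀
    rw [map_smul, Matrix.toLin'_apply]
    exact Submodule.smul_mem _ c (Submodule.subset_span ⟨⟨j, hj⟩, rfl⟩)
  have hcard : Fintype.card ↥t = Module.finrank K (Fin p → K) := by
    rw [Fintype.card_coe, Module.finrank_fin_fun]; exact htrank.symm
  have hli := linearIndependent_of_top_le_span_of_card_eq_finrank hspan hcard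
  let b₀ := Module.Basis.mk hli hspan
  have hcard' : Fintype.card ↥t = p := by rw [Fintype.card_coe]; exact htrank.symm
  let b := b₀.reindex (Fintype.equivFinOfCardEq hcard')
  have hb : ∀ i, ∃ j : ↥t, b i = f j := fun i =>
    ⟨(Fintype.equivFinOfCardEq hcard').symm i, by simp [b, b₀, Module.Basis.reindex_apply]⟩
  -- each `j v` is a common eigenvector of `N`
  have heig : ∀ x ∈ N, ∀ i, ∃ c : K, ((x : GL (Fin p) K) : Matrix (Fin p) (Fin p) K) *ᵥ b i = c • b i := by
    intro x hx i
    obtain ⟨j, hj⟩ := hb i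
    rw [hj]
    have hmem : (((((j : H) : GL (Fin p) K))⁻¹ * x * ((j : H) : GL (Fin p) K) : GL (Fin p) K) : Matrix (Fin p) (Fin p) K) *ᵥ
        (v₁ : Fin p → K) ∈ W₁ := hst _ (hnorm' _ (j : H).2 x hx) _ v₁.2
    obtain ⟨c, hc⟩ := hW₁v _ hmem
    refine ⟨c, ?_⟩
    have hgx : (x : GL (Fin p) K) * ((j : H) : GL (Fin p) K) =
        ((j : H) : GL (Fin p) K) * ((((j : H) : GL (Fin p) K))⁻¹ * x * ((j : H) : GL (Fin p) K)) := by
      group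
    simp only [f]
    rw [Matrix.mulVec_mulVec, ← Units.val_mul, hgx, Units.val_mul, ← Matrix.mulVec_mulVec, ← hc,
      Matrix.mulVec_smul]
  refine ⟨b, fun x i => b.repr (((x : GL (Fin p) K) : Matrix (Fin p) (Fin p) K) *ᵥ b i) i, fun x hx i => ?_⟩
  obtain ⟨c, hc⟩ := heig x hx i
  dsimp only
  rw [hc, map_smul, Finsupp.smul_apply, b.repr_self, Finsupp.single_eq_same, smul_eq_mul, mul_one]

omit hp in
/-- Distinct characters: `H` permutes the common eigenlines of `N`. [folklore] -/
theorem perm_of_distinct {H N : Subgroup (GL (Fin p) K)}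
    (hnorm : ∀ h ∈ H, ∀ x ∈ N, h * x * h⁻¹ ∈ N)
    (b : Module.Basis (Fin p) K (Fin p → K)) (χ : GL (Fin p) K → Fin p → K)
    (hdiag : ∀ x ∈ N, ∀ i, ((x : GL (Fin p) K) : Matrix (Fin p) (Fin p) K) *ᵥ b i = χ x i • b i)
    (hdist : ∀ i j, i ≠ j → ∃ x ∈ N, χ x i ≠ χ x j) :
    ∀ h ∈ H, ∀ i, ∃ (j : Fin p) (c : K), ((h : GL (Fin p) K) : Matrix (Fin p) (Fin p) K) *ᵥ b i = c • b j := by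
  intro h hh i
  refine exists_eq_smul_basis_of_eigenvector b χ hdiag hdist ?_ ?_
  · intro h0
    apply b.ne_zero i
    refine toLin'_units_injective h ?_
    rw [Matrix.toLin'_apply, Matrix.toLin'_apply, h0, Matrix.mulVec_zero]
  · intro x hx
    have hx' : h⁻¹ * x * h ∈ N := by simpa only [inv_inv] using hnorm h⁻¹ (H.inv_mem hh) x hx
    refine ⟨χ (h⁻¹ * x * h) i, ?_⟩
    have hgx : x * h = h * (h⁻¹ * x * h) := by group
    rw [Matrix.mulVec_mulVec, ← Units.val_mul, hgx, Units.val_mul, ← Matrix.mulVec_mulVec,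
      hdiag _ hx' i, Matrix.mulVec_smul]

/-- A coincidence of characters: then `N` is scalar.  The joint eigenspaces of the conjugate
characters are coordinate blocks of a common size `e ≥ 2`; they are permuted by `H`, cover (by
irreducibility) and pairwise coincide or are disjoint, so `e ∣ p`, `e = p`. [folklore] -/
theorem scalar_of_coincidence {H N : Subgroup (GL (Fin p) K)} [Finite H]
    (hirr : (glRepresentation H.subtype).IsIrreducible)
    (hnorm : ∀ h ∈ H, ∀ x ∈ N, h * x * h⁻¹ ∈ N)
    (b : Module.Basis (Fin p) K (Fin p → K)) (χ : GL (Fin p) K → Fin p → K)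
    (hdiag : ∀ x ∈ N, ∀ i, ((x : GL (Fin p) K) : Matrix (Fin p) (Fin p) K) *ᵥ b i = χ x i • b i)
    {i₀ j₀ : Fin p} (hne : i₀ ≠ j₀) (hco : ∀ x ∈ N, χ x i₀ = χ x j₀) :
    ∀ x ∈ N, ∃ c : K, ((x : GL (Fin p) K) : Matrix (Fin p) (Fin p) K) = c • 1 := by
  classical
  haveI : Fintype H := Fintype.ofFinite H
  have hnorm' : ∀ h ∈ H, ∀ x ∈ N, h⁻¹ * x * h ∈ N := fun h hh x hx => by
    simpa only [inv_inv] using hnorm h⁻¹ (H.inv_mem hh) x hx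
  -- joint eigenspaces of a "character" `ψ` and their index sets (as opaque local functions)
  obtain ⟨E, hE⟩ : ∃ E : (GL (Fin p) K → K) → Submodule K (Fin p → K), ∀ ψ,
      E ψ = ⨅ x : N, Module.End.eigenspace (Matrix.toLin' ((x : GL (Fin p) K) : Matrix (Fin p) (Fin p) K)) (ψ x) :=
    ⟨_, fun _ => rfl⟩
  obtain ⟨C, hC⟩ : ∃ C : (GL (Fin p) K → K) → Finset (Fin p), ∀ ψ,
      C ψ = Finset.univ.filter fun i => ∀ x ∈ N, χ x i = ψ x :=
    ⟨_, fun _ => rfl⟩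
  have hmemE : ∀ ψ v, v ∈ E ψ ↔ ∀ x ∈ N, ((x : GL (Fin p) K) : Matrix (Fin p) (Fin p) K) *ᵥ v = ψ x • v := by
    intro ψ v
    rw [hE]
    simp only [Submodule.mem_iInf, Module.End.mem_eigenspace_iff, Matrix.toLin'_apply,
      Subtype.forall]
  have hmemC : ∀ ψ i, i ∈ C ψ ↔ ∀ x ∈ N, χ x i = ψ x := by
    intro ψ i
    rw [hC]
    simp only [Finset.mem_filter, Finset.mem_univ, true_and]
  -- `E ψ` is the coordinate block on `C ψ`
  have hEeq : ∀ ψ, E ψ = Submodule.span K (b '' (C ψ : Set (Fin p))) := by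
    intro ψ
    apply le_antisymm
    · intro v hv
      replace hv := (hmemE ψ v).1 hv
      rw [Module.Basis.mem_span_image]
      intro i hi
      rw [Finset.mem_coe, Finsupp.mem_support_iff] at hi
      rw [Finset.mem_coe, hmemC]
      intro x hx
      have e := repr_mulVec_of_diag b χ hdiag hx v i
      rw [hv x hx, map_smul, Finsupp.smul_apply, smul_eq_mul, mul_comm] at e
      exact (mul_left_cancel₀ hi e).symm
    · rw [Submodule.span_le]
      rintro _ ⟨i, hi, rfl⟩
      rw [Finset.mem_coe, hmemC] at hi
      refine (hmemE ψ (b i)).2 fun x hx => ?_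
      rw [hdiag x hx i, hi x hx]
  have hfinrank : ∀ ψ, Module.finrank K (E ψ) = (C ψ).card := by
    intro ψ
    rw [hEeq ψ]
    have hli : LinearIndependent K (fun i : C ψ => b i) :=
      b.linearIndependent.comp _ Subtype.val_injective
    have hrange : Set.range (fun i : C ψ => b i) = b '' (C ψ : Set (Fin p)) := by
      ext v
      simp only [Set.mem_range, Set.mem_image, Finset.mem_coe, Subtype.exists, exists_prop]
    rw [← hrange, finrank_span_eq_card hli, Fintype.card_coe]
  -- transport by `g ∈ H`
  have hmapE : ∀ g ∈ H, ∀ ψ : GL (Fin p) K → K,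
      (E ψ).map (Matrix.toLin' ((g : GL (Fin p) K) : Matrix (Fin p) (Fin p) K)) ≤ E (fun x => ψ (g⁻¹ * x * g)) := by
    intro g hg ψ v hv
    rw [Submodule.mem_map] at hv
    obtain ⟨w, hw, rfl⟩ := hv
    replace hw := (hmemE ψ w).1 hw
    refine (hmemE (fun x => ψ (g⁻¹ * x * g)) (Matrix.toLin' ((g : GL (Fin p) K) : Matrix (Fin p) (Fin p) K) w)).2
      fun x hx => ?_
    have hgx : x * g = g * (g⁻¹ * x * g) := by group
    rw [Matrix.toLin'_apply, Matrix.mulVec_mulVec, ← Units.val_mul, hgx, Units.val_mul,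
      ← Matrix.mulVec_mulVec, hw _ (hnorm' g hg x hx), Matrix.mulVec_smul]
  have hcardle : ∀ g ∈ H, ∀ ψ : GL (Fin p) K → K,
      (C ψ).card ≤ (C (fun x => ψ (g⁻¹ * x * g))).card := by
    intro g hg ψ
    rw [← hfinrank, ← hfinrank, ← finrank_map_units g (E ψ)]
    exact Submodule.finrank_mono (hmapE g hg ψ)
  have hcardC : ∀ g ∈ H, ∀ ψ : GL (Fin p) K → K,
      (C (fun x => ψ (g⁻¹ * x * g))).card = (C ψ).card := by
    intro g hg ψ
    refine le_antisymm ?_ (hcardle g hg ψ)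
    have h2 := hcardle g⁻¹ (H.inv_mem hg) (fun x => ψ (g⁻¹ * x * g))
    have hfun : (fun x => (fun x => ψ (g⁻¹ * x * g)) (g⁻¹⁻¹ * x * g⁻¹)) = ψ := by
      funext x
      simp only [inv_inv]
      congr 1
      group
    rwa [hfun] at h2
  -- coincide-or-disjoint
  have hCdisj : ∀ ψ₁ ψ₂ : GL (Fin p) K → K, C ψ₁ = C ψ₂ ∨ Disjoint (C ψ₁) (C ψ₂) := by
    intro ψ₁ ψ₂
    by_cases h : Disjoint (C ψ₁) (C ψ₂)
    · exact Or.inr h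
    · left
      rw [Finset.not_disjoint_iff] at h
      obtain ⟨i, h1, h2⟩ := h
      rw [hmemC] at h1 h2
      ext j
      rw [hmemC, hmemC]
      exact ⟨fun hj x hx => by rw [hj x hx, ← h1 x hx, h2 x hx],
        fun hj x hx => by rw [hj x hx, ← h2 x hx, h1 x hx]⟩
  -- the blocks of the conjugates of the character of `b i₀`
  let ψ₀ : GL (Fin p) K → K := fun x => χ x i₀
  let Cg : H → Finset (Fin p) := fun g => C (fun x => ψ₀ ((g : GL (Fin p) K)⁻¹ * x * g))
  have hCg_card : ∀ g, (Cg g).card = (C ψ₀).card := fun g => hcardC g g.2 ψ₀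
  -- they cover, by irreducibility of `H`
  have hcov : ∀ a : Fin p, ∃ g : H, a ∈ Cg g := by
    obtain ⟨Y, hY⟩ : ∃ Y : H → Submodule K (Fin p → K), ∀ g,
        Y g = E (fun x => ψ₀ ((g : GL (Fin p) K)⁻¹ * x * g)) := ⟨_, fun _ => rfl⟩
    have hYst : ∀ g₁ ∈ H, ∀ v ∈ (⨆ g, Y g), ((g₁ : GL (Fin p) K) : Matrix (Fin p) (Fin p) K) *ᵥ v ∈ (⨆ g, Y g) := by
      intro g₁ hg₁ v hv
      have hle : (⨆ g, Y g) ≤ (⨆ g, Y g).comap (Matrix.toLin' ((g₁ : GL (Fin p) K) : Matrix (Fin p) (Fin p) K)) := by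
        refine iSup_le fun g => ?_
        intro w hw
        rw [Submodule.mem_comap]
        rw [hY] at hw
        have h1 : Matrix.toLin' ((g₁ : GL (Fin p) K) : Matrix (Fin p) (Fin p) K) w ∈
            (E (fun x => ψ₀ ((g : GL (Fin p) K)⁻¹ * x * g))).map
              (Matrix.toLin' ((g₁ : GL (Fin p) K) : Matrix (Fin p) (Fin p) K)) := Submodule.mem_map_of_mem hw
        have h2 := hmapE g₁ hg₁ (fun x => ψ₀ ((g : GL (Fin p) K)⁻¹ * x * g)) h1
        have hfun : (fun x => (fun x => ψ₀ ((g : GL (Fin p) K)⁻¹ * x * g)) (g₁⁻¹ * x * g₁)) =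
            fun x => ψ₀ (((⟨g₁, hg₁⟩ * g : H) : GL (Fin p) K)⁻¹ * x * (⟨g₁, hg₁⟩ * g : H)) := by
          funext x
          simp only [Subgroup.coe_mul]
          congr 1
          group
        rw [hfun, ← hY] at h2
        exact le_iSup Y (⟨g₁, hg₁⟩ * g) h2
      have := hle hv
      rwa [Submodule.mem_comap, Matrix.toLin'_apply] at this
    have hYtop : (⨆ g, Y g) = ⊤ := by
      rcases eq_bot_or_eq_top_of_stable hirr _ hYst with h0 | h1
      · exfalso
        have hi₀ : b i₀ ∈ Y 1 := by
          rw [hY]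
          refine (hmemE (fun x => ψ₀ (((1 : H) : GL (Fin p) K)⁻¹ * x * (1 : H))) (b i₀)).2
            fun x hx => ?_
          simp only [ψ₀, Subgroup.coe_one, inv_one, one_mul, mul_one]
          exact hdiag x hx i₀
        have : b i₀ ∈ (⨆ g, Y g) := le_iSup Y 1 hi₀
        rw [h0, Submodule.mem_bot] at this
        exact b.ne_zero i₀ this
      · exact h1
    intro a
    by_contra hno
    push Not at hno
    have hsub : (⨆ g, Y g) ≤
        Submodule.span K (b '' ((Finset.univ.biUnion Cg : Finset (Fin p)) : Set (Fin p))) := by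
      refine iSup_le fun g => ?_
      rw [hY, hEeq]
      refine Submodule.span_mono (Set.image_mono fun i hi => ?_)
      rw [Finset.mem_coe] at hi ⊢
      exact Finset.mem_biUnion.2 ⟨g, Finset.mem_univ _, hi⟩
    have ha : b a ∈ Submodule.span K (b '' ((Finset.univ.biUnion Cg : Finset (Fin p)) : Set (Fin p))) :=
      hsub (hYtop ▸ Submodule.mem_top)
    have hnot : a ∉ ((Finset.univ.biUnion Cg : Finset (Fin p)) : Set (Fin p)) := by
      rw [Finset.mem_coe, Finset.mem_biUnion]
      rintro ⟨g, -, hg⟩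
      exact hno g hg
    exact b.linearIndependent.notMem_span_image hnot ha
  -- count: the common block size divides `p` and is at least `2`
  have hdvd := dvd_card_of_blocks Cg _ hCg_card (fun g g' => hCdisj _ _) hcov
  rw [Fintype.card_fin] at hdvd
  have h2 : 1 < (C ψ₀).card := by
    rw [Finset.one_lt_card]
    refine ⟨i₀, ?_, j₀, ?_, hne⟩
    · rw [hmemC]; intro x hx; rfl
    · rw [hmemC]; intro x hx; exact (hco x hx).symm
  have hcardp : (C ψ₀).card = p := by
    rcases (Nat.dvd_prime hp.out).1 hdvd with h | h
    · omega
    · exact h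
  have huniv : C ψ₀ = Finset.univ :=
    Finset.eq_univ_of_card _ (by rw [hcardp, Fintype.card_fin])
  -- conclude
  intro x hx
  refine ⟨χ x i₀, ?_⟩
  refine MonomialAdequacy.matrix_eq_of_mulVec_basis b fun i => ?_
  have hi : i ∈ C ψ₀ := huniv ▸ Finset.mem_univ i
  rw [hmemC] at hi
  rw [hdiag x hx i, hi x hx, Matrix.smul_mulVec, Matrix.one_mulVec]

/-- **Clifford's theorem in prime degree** (`H ≤ GL_p(K)` finite irreducible, `N` normalised by
`H`, `K` any field): `N` is irreducible, OR `N` consists of scalars, OR `Kᵖ` has a basis of common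
eigenvectors of `N` with pairwise distinct characters whose lines are permuted by `H`. [folklore] -/
theorem clifford {H N : Subgroup (GL (Fin p) K)} [Finite H]
    (hirr : (glRepresentation H.subtype).IsIrreducible)
    (hnorm : ∀ h ∈ H, ∀ x ∈ N, h * x * h⁻¹ ∈ N) :
    (glRepresentation N.subtype).IsIrreducible ∨
    (∀ x ∈ N, ∃ c : K, ((x : GL (Fin p) K) : Matrix (Fin p) (Fin p) K) = c • 1) ∨
    ∃ (b : Module.Basis (Fin p) K (Fin p → K)) (χ : GL (Fin p) K → Fin p → K),
      (∀ h ∈ H, ∀ i, ∃ (j : Fin p) (c : K), ((h : GL (Fin p) K) : Matrix (Fin p) (Fin p) K) *ᵥ b i = c • b j) ∧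
      (∀ x ∈ N, ∀ i, ((x : GL (Fin p) K) : Matrix (Fin p) (Fin p) K) *ᵥ b i = χ x i • b i) ∧
      (∀ i j, i ≠ j → ∃ x ∈ N, χ x i ≠ χ x j) := by
  classical
  by_cases hN : (glRepresentation N.subtype).IsIrreducible
  · exact Or.inl hN
  right
  -- a proper non-zero `N`-stable subspace, and an `N`-minimal one inside it
  have hnt : Nontrivial (Subrepresentation (glRepresentation N.subtype)) := by
    refine ⟨⟨⊥, ⊤, fun h => ?_⟩⟩
    have h' : (⊥ : Submodule K (Fin p → K)) = ⊤ := congrArg Subrepresentation.toSubmodule h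
    have hv : (Pi.single ⟨0, hp.out.pos⟩ (1 : K) : Fin p → K) ∈ (⊥ : Submodule K (Fin p → K)) :=
      h' ▸ Submodule.mem_top
    rw [Submodule.mem_bot] at hv
    exact (one_ne_zero (α := K)) (by simpa using congrFun hv ⟨0, hp.out.pos⟩)
  have hex : ∃ W : Subrepresentation (glRepresentation N.subtype), W ≠ ⊥ ∧ W ≠ ⊤ := by
    by_contra hne
    push Not at hne
    exact hN ⟨fun W => (eq_or_ne W ⊥).imp_right (hne W)⟩
  obtain ⟨W, hWb, hWt⟩ := hex
  obtain ⟨a, ha, haW⟩ := Subrepresentation.exists_isAtom_le W hWb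
  have hW₁b : a.toSubmodule ≠ ⊥ := fun h =>
    ha.1 (Subrepresentation.toSubmodule_injective h)
  have hW₁t : a.toSubmodule ≠ ⊤ := by
    intro h
    apply hWt
    apply Subrepresentation.toSubmodule_injective
    exact eq_top_iff.2 (h.symm.le.trans haW)
  have hst : ∀ x ∈ N, ∀ v ∈ a.toSubmodule, ((x : GL (Fin p) K) : Matrix (Fin p) (Fin p) K) *ᵥ v ∈ a.toSubmodule :=
    fun x hx v hv => a.apply_mem_toSubmodule ⟨x, hx⟩ hv
  have hmin : ∀ W' : Submodule K (Fin p → K),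
      (∀ x ∈ N, ∀ v ∈ W', ((x : GL (Fin p) K) : Matrix (Fin p) (Fin p) K) *ᵥ v ∈ W') → W' ≤ a.toSubmodule →
      W' = ⊥ ∨ W' = a.toSubmodule := by
    intro W' hW' hle
    let W'' : Subrepresentation (glRepresentation N.subtype) := ⟨W', fun x v hv => hW' x x.2 v hv⟩
    rcases ha.le_iff.1 (show W'' ≤ a from hle) with h0 | h1
    · exact Or.inl (congrArg Subrepresentation.toSubmodule h0)
    · exact Or.inr (congrArg Subrepresentation.toSubmodule h1)
  obtain ⟨b, χ, hdiag⟩ := exists_eigenbasis_of_minimal hirr hnorm hW₁b hW₁t hst hmin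
  by_cases hdist : ∀ i j, i ≠ j → ∃ x ∈ N, χ x i ≠ χ x j
  · exact Or.inr ⟨b, χ, perm_of_distinct hnorm b χ hdiag hdist, hdiag, hdist⟩
  · left
    push Not at hdist
    obtain ⟨i₀, j₀, hne, hco⟩ := hdist
    exact scalar_of_coincidence hirr hnorm b χ hdiag hne hco

end Clifford

/-! ### Permutation groups of prime degree: abelian normal subgroups of transitive groups -/

section PermPrime

variable {p : ℕ} [hp : Fact p.Prime]

/-- **An abelian subgroup `N ≤ S_p` normalised by a transitive `T ≤ S_p` is trivial or has order
`p`.**  The `N`-orbits are permuted transitively by `T`, so they have a common size dividing `p`;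
if `N ≠ 1` this size is `p`, `N` is transitive, and an abelian transitive group is regular.
[folklore] -/
theorem eq_bot_or_card_eq_of_comm_of_transitive {T N : Subgroup (Equiv.Perm (Fin p))}
    (hnorm : ∀ t ∈ T, ∀ n ∈ N, t * n * t⁻¹ ∈ N)
    (hcomm : ∀ x ∈ N, ∀ y ∈ N, x * y = y * x)
    (htrans : ∀ i j : Fin p, ∃ t ∈ T, t i = j) :
    N = ⊥ ∨ Nat.card N = p := by
  classical
  by_cases hN : N = ⊥
  · exact Or.inl hN
  right
  obtain ⟨n, hnN, hn1⟩ : ∃ n ∈ N, n ≠ 1 := by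
    by_contra h
    push Not at h
    exact hN ((Subgroup.eq_bot_iff_forall _).2 h)
  obtain ⟨i₀, hi₀⟩ : ∃ i, n i ≠ i := by
    by_contra h
    push Not at h
    exact hn1 (Equiv.ext h)
  -- the `N`-orbits
  let O : Fin p → Finset (Fin p) := fun i => Finset.univ.filter fun j => ∃ m ∈ N, m i = j
  have hmemO : ∀ i j, j ∈ O i ↔ ∃ m ∈ N, m i = j := by
    intro i j
    simp only [O, Finset.mem_filter, Finset.mem_univ, true_and]
  have hOimage : ∀ t ∈ T, ∀ i, (O i).image t = O (t i) := by
    intro t ht i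
    ext j
    simp only [Finset.mem_image, hmemO]
    constructor
    · rintro ⟨j', ⟨m, hm, rfl⟩, rfl⟩
      exact ⟨t * m * t⁻¹, hnorm t ht m hm, by simp⟩
    · rintro ⟨m, hm, rfl⟩
      refine ⟨(t⁻¹ * m * t) i, ⟨t⁻¹ * m * t, ?_, rfl⟩, by simp⟩
      simpa using hnorm t⁻¹ (T.inv_mem ht) m hm
  have hcardO : ∀ i, (O i).card = (O i₀).card := by
    intro i
    obtain ⟨t, ht, rfl⟩ := htrans i₀ i
    rw [← hOimage t ht i₀, Finset.card_image_of_injective _ t.injective]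
  have hOdisj : ∀ i j, O i = O j ∨ Disjoint (O i) (O j) := by
    intro i j
    by_cases h : Disjoint (O i) (O j)
    · exact Or.inr h
    left
    rw [Finset.not_disjoint_iff] at h
    obtain ⟨k, hki, hkj⟩ := h
    rw [hmemO] at hki hkj
    obtain ⟨m₁, hm₁, rfl⟩ := hki
    obtain ⟨m₂, hm₂, hm₂k⟩ := hkj
    ext l
    rw [hmemO, hmemO]
    constructor
    · rintro ⟨m, hm, rfl⟩
      refine ⟨m * m₁⁻¹ * m₂, N.mul_mem (N.mul_mem hm (N.inv_mem hm₁)) hm₂, ?_⟩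
      simp [hm₂k]
    · rintro ⟨m, hm, rfl⟩
      refine ⟨m * m₂⁻¹ * m₁, N.mul_mem (N.mul_mem hm (N.inv_mem hm₂)) hm₁, ?_⟩
      simp [← hm₂k]
  have hcov : ∀ a, ∃ i, a ∈ O i := fun a => ⟨a, (hmemO a a).2 ⟨1, N.one_mem, rfl⟩⟩
  have hdvd := dvd_card_of_blocks O _ hcardO hOdisj hcov
  rw [Fintype.card_fin] at hdvd
  have h2 : 1 < (O i₀).card :=
    Finset.one_lt_card.2 ⟨n i₀, (hmemO _ _).2 ⟨n, hnN, rfl⟩, i₀, (hmemO _ _).2 ⟨1, N.one_mem, rfl⟩, hi₀⟩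
  have hcardp : (O i₀).card = p := by
    rcases (Nat.dvd_prime hp.out).1 hdvd with h | h
    · omega
    · exact h
  have huniv : O i₀ = Finset.univ :=
    Finset.eq_univ_of_card _ (by rw [hcardp, Fintype.card_fin])
  have hNtrans : ∀ j, ∃ m ∈ N, m i₀ = j := fun j => (hmemO i₀ j).1 (huniv ▸ Finset.mem_univ j)
  -- regularity: `m ↦ m i₀` is a bijection `N → Fin p`
  have hinj : Function.Injective (fun m : N => (m : Equiv.Perm (Fin p)) i₀) := by
    intro m₁ m₂ h
    dsimp only at h
    apply Subtype.ext
    refine Equiv.ext fun j => ?_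
    obtain ⟨m, hm, rfl⟩ := hNtrans j
    have e1 : (m₁ : Equiv.Perm (Fin p)) * m = m * m₁ := hcomm _ m₁.2 _ hm
    have e2 : (m₂ : Equiv.Perm (Fin p)) * m = m * m₂ := hcomm _ m₂.2 _ hm
    calc (m₁ : Equiv.Perm (Fin p)) (m i₀) = ((m₁ : Equiv.Perm (Fin p)) * m) i₀ := by
          rw [Equiv.Perm.mul_apply]
      _ = m ((m₁ : Equiv.Perm (Fin p)) i₀) := by rw [e1, Equiv.Perm.mul_apply]
      _ = m ((m₂ : Equiv.Perm (Fin p)) i₀) := by rw [h]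
      _ = ((m₂ : Equiv.Perm (Fin p)) * m) i₀ := by rw [e2, Equiv.Perm.mul_apply]
      _ = (m₂ : Equiv.Perm (Fin p)) (m i₀) := by rw [Equiv.Perm.mul_apply]
  have hsurj : Function.Surjective (fun m : N => (m : Equiv.Perm (Fin p)) i₀) := fun j => by
    obtain ⟨m, hm, hmj⟩ := hNtrans j
    exact ⟨⟨m, hm⟩, hmj⟩
  rw [Nat.card_eq_of_bijective _ ⟨hinj, hsurj⟩, Nat.card_eq_fintype_card, Fintype.card_fin]

end PermPrime

/-! ### No normal subgroup of a primitive group has a line structure with non-scalar kernel -/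

section LinesNormal

variable {p : ℕ} [hp : Fact p.Prime] [CharP K p] [IsAlgClosed K]


/-- **Key lemma.**  Let `H ≤ GL_p(K)` (`K = K̄` of characteristic `p`) be finite, irreducible and
PRIMITIVE in the sense that every line-permutation structure of `H` has central kernel.  Let
`L ≤ H` be normalised by `H` and irreducible.  Then no line-permutation structure `(b, θ)` of `L`
has a non-scalar element in its kernel.  (For `h ∈ H`, Clifford applied to `A ∩ hAh⁻¹ ⊴ L`, `A` the
kernel: either `h` permutes the lines of `b`, or `A ∩ hAh⁻¹` is scalar.  If every `h` permutes the
lines, primitivity makes `A` central, i.e. scalar.  Otherwise `θ(hAh⁻¹)` is an abelian normal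
subgroup of the transitive `θ(L) ≤ S_p`, so it is trivial — then `hAh⁻¹ = A` — or of order `p` —
but `A`, being diagonalisable, is a `p'`-group.) [folklore] -/
theorem false_of_lines_of_normal {H L : Subgroup (GL (Fin p) K)} [Finite H]
    (hirrH : (glRepresentation H.subtype).IsIrreducible)
    (hmono : ∀ (b : Module.Basis (Fin p) K (Fin p → K)) (θ : ↥H →* Equiv.Perm (Fin p)),
      (∀ (h : H) (i : Fin p), ∃ c : K, ((h : GL (Fin p) K) : Matrix (Fin p) (Fin p) K) *ᵥ b i = c • b (θ h i)) →
      θ.ker ≤ Subgroup.center H)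
    (hLH : L ≤ H) (hnorm : ∀ h ∈ H, ∀ x ∈ L, h * x * h⁻¹ ∈ L)
    (hirrL : (glRepresentation L.subtype).IsIrreducible)
    (b : Module.Basis (Fin p) K (Fin p → K)) (θ : ↥L →* Equiv.Perm (Fin p))
    (hθ : ∀ (y : L) (i : Fin p), ∃ c : K, ((y : GL (Fin p) K) : Matrix (Fin p) (Fin p) K) *ᵥ b i = c • b (θ y i))
    {a : L} (ha : θ a = 1) (hans : ∀ c : K, ((a : GL (Fin p) K) : Matrix (Fin p) (Fin p) K) ≠ c • 1) : False := by
  classical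
  haveI : Finite L := Finite.of_injective _ (Subgroup.inclusion_injective hLH)
  have hnorm' : ∀ h ∈ H, ∀ x ∈ L, h⁻¹ * x * h ∈ L := fun h hh x hx => by
    simpa only [inv_inv] using hnorm h⁻¹ (H.inv_mem hh) x hx
  choose c hc using hθ
  -- the kernel `A` of the line structure, as a subgroup of `GL_p(K)`
  let A : Subgroup (GL (Fin p) K) := θ.ker.map L.subtype
  have hAker : ∀ y : L, (y : GL (Fin p) K) ∈ A ↔ θ y = 1 := by
    intro y
    constructor
    · rintro ⟨y', hy', hyy'⟩
      have : y' = y := Subtype.ext hyy'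
      subst this
      exact hy'
    · intro hy
      exact ⟨y, hy, rfl⟩
  have hAL : A ≤ L := fun x ⟨y, _, hy⟩ => hy ▸ y.2
  have hAmem : ∀ x ∈ A, ∃ y : L, (y : GL (Fin p) K) = x ∧ θ y = 1 := by
    rintro x ⟨y, hy, rfl⟩
    exact ⟨y, rfl, hy⟩
  have hAdiag : ∀ x ∈ A, ∀ i, ∃ d : K, ((x : GL (Fin p) K) : Matrix (Fin p) (Fin p) K) *ᵥ b i = d • b i ∧ d ≠ 0 := by
    intro x hx i
    obtain ⟨y, rfl, hy⟩ := hAmem x hx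
    exact ⟨c y i, MonomialAdequacy.mulVec_basis_of_ker b θ c hc y hy i,
      MonomialAdequacy.monomialCoef_ne_zero b θ c hc y i⟩
  have hdiag_comm : ∀ x x' : GL (Fin p) K,
      (∀ i, ∃ d : K, ((x : GL (Fin p) K) : Matrix (Fin p) (Fin p) K) *ᵥ b i = d • b i) →
      (∀ i, ∃ d : K, ((x' : GL (Fin p) K) : Matrix (Fin p) (Fin p) K) *ᵥ b i = d • b i) → x * x' = x' * x := by
    intro x x' hx hx'
    apply Units.ext
    rw [Units.val_mul, Units.val_mul]
    refine MonomialAdequacy.matrix_eq_of_mulVec_basis b fun i => ?_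
    obtain ⟨d, hd⟩ := hx i
    obtain ⟨d', hd'⟩ := hx' i
    rw [← Matrix.mulVec_mulVec, ← Matrix.mulVec_mulVec, hd, hd', Matrix.mulVec_smul,
      Matrix.mulVec_smul, hd, hd', smul_smul, smul_smul, mul_comm]
  have hAcomm : ∀ x ∈ A, ∀ x' ∈ A, x * x' = x' * x := fun x hx x' hx' =>
    hdiag_comm x x' (fun i => (hAdiag x hx i).imp fun d hd => hd.1)
      (fun i => (hAdiag x' hx' i).imp fun d hd => hd.1)
  have hAnormL : ∀ y ∈ L, ∀ x ∈ A, y * x * y⁻¹ ∈ A := by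
    intro y hy x hx
    obtain ⟨x₀, rfl, hx₀⟩ := hAmem x hx
    have : ((⟨y, hy⟩ * x₀ * ⟨y, hy⟩⁻¹ : L) : GL (Fin p) K) = y * x₀ * y⁻¹ := rfl
    rw [← this, hAker]
    rw [map_mul, map_mul, hx₀, mul_one, map_inv, mul_inv_cancel]
  have hAcard : ¬ p ∣ Nat.card A := by
    rw [show Nat.card A = Nat.card θ.ker from Subgroup.card_subtype L θ.ker]
    exact MonomialAdequacy.not_dvd_card_ker b θ c hc
  have haA : (a : GL (Fin p) K) ∈ A := (hAker a).2 ha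
  -- conjugates of `A`
  let Ag : GL (Fin p) K → Subgroup (GL (Fin p) K) := fun g => A.map (MulAut.conj g).toMonoidHom
  have hmemAg : ∀ g x, x ∈ Ag g ↔ ∃ x₀ ∈ A, g * x₀ * g⁻¹ = x := by
    intro g x
    simp only [Ag, Subgroup.mem_map, MulEquiv.coe_toMonoidHom, MulAut.conj_apply]
  have hAgL : ∀ g ∈ H, Ag g ≤ L := by
    intro g hg x hx
    obtain ⟨x₀, hx₀, rfl⟩ := (hmemAg g x).1 hx
    exact hnorm g hg x₀ (hAL hx₀)
  have hAgnormL : ∀ g ∈ H, ∀ y ∈ L, ∀ x ∈ Ag g, y * x * y⁻¹ ∈ Ag g := by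
    intro g hg y hy x hx
    obtain ⟨x₀, hx₀, rfl⟩ := (hmemAg g x).1 hx
    refine (hmemAg g _).2 ⟨(g⁻¹ * y * g) * x₀ * (g⁻¹ * y * g)⁻¹,
      hAnormL _ (hnorm' g hg y hy) x₀ hx₀, by group⟩
  have hAgdiag : ∀ g, ∀ x ∈ Ag g, ∀ i, ∃ d : K,
      ((x : GL (Fin p) K) : Matrix (Fin p) (Fin p) K) *ᵥ (((g : GL (Fin p) K) : Matrix (Fin p) (Fin p) K) *ᵥ b i) =
        d • (((g : GL (Fin p) K) : Matrix (Fin p) (Fin p) K) *ᵥ b i) := by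
    intro g x hx i
    obtain ⟨x₀, hx₀, rfl⟩ := (hmemAg g x).1 hx
    obtain ⟨d, hd, -⟩ := hAdiag x₀ hx₀ i
    refine ⟨d, ?_⟩
    rw [Matrix.mulVec_mulVec, Units.val_mul, Units.val_mul, Matrix.mul_assoc, Matrix.mul_assoc,
      ← Units.val_mul, inv_mul_cancel, Units.val_one, Matrix.mul_one, ← Matrix.mulVec_mulVec, hd,
      Matrix.mulVec_smul]
  have hAgcomm : ∀ g, ∀ x ∈ Ag g, ∀ x' ∈ Ag g, x * x' = x' * x := by
    intro g x hx x' hx'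
    obtain ⟨x₀, hx₀, rfl⟩ := (hmemAg g x).1 hx
    obtain ⟨x₀', hx₀', rfl⟩ := (hmemAg g x').1 hx'
    have := hAcomm x₀ hx₀ x₀' hx₀'
    calc g * x₀ * g⁻¹ * (g * x₀' * g⁻¹) = g * (x₀ * x₀') * g⁻¹ := by group
      _ = g * (x₀' * x₀) * g⁻¹ := by rw [this]
      _ = g * x₀' * g⁻¹ * (g * x₀ * g⁻¹) := by group
  have hAgcard : ∀ g, Nat.card (Ag g) = Nat.card A := fun g =>
    Subgroup.card_map_of_injective (MulAut.conj g).injective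
  -- the dichotomy for `g ∈ H`: `g` permutes the lines of `b`, or `A ∩ gAg⁻¹` is scalar
  have hPQ : ∀ g ∈ H, (∀ i, ∃ (j : Fin p) (d : K), ((g : GL (Fin p) K) : Matrix (Fin p) (Fin p) K) *ᵥ b i = d • b j) ∨
      (∀ x ∈ A ⊓ Ag g, ∃ e : K, ((x : GL (Fin p) K) : Matrix (Fin p) (Fin p) K) = e • 1) := by
    intro g hg
    have hnorm₂ : ∀ y ∈ L, ∀ x ∈ A ⊓ Ag g, y * x * y⁻¹ ∈ A ⊓ Ag g := fun y hy x hx =>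
      Subgroup.mem_inf.2 ⟨hAnormL y hy x (Subgroup.mem_inf.1 hx).1,
        hAgnormL g hg y hy x (Subgroup.mem_inf.1 hx).2⟩
    rcases clifford (H := L) (N := A ⊓ Ag g) hirrL hnorm₂ with hirr₂ | hsc₂ |
        ⟨b'', χ'', -, hdiag'', hdist''⟩
    · exact (not_isIrreducible_of_comm (fun x hx x' hx' =>
        hAcomm x (Subgroup.mem_inf.1 hx).1 x' (Subgroup.mem_inf.1 hx').1) hirr₂).elim
    · exact Or.inr hsc₂
    · left
      -- both `b i` and `g b i` are common eigenvectors of `A ∩ gAg⁻¹`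
      have h1 : ∀ i, ∃ (k : Fin p) (d : K), b i = d • b'' k := fun i =>
        exists_eq_smul_basis_of_eigenvector b'' χ'' hdiag'' hdist'' (b.ne_zero i)
          fun x hx => (hAdiag x (Subgroup.mem_inf.1 hx).1 i).imp fun d hd => hd.1
      have h2 : ∀ i, ∃ (k : Fin p) (d : K), ((g : GL (Fin p) K) : Matrix (Fin p) (Fin p) K) *ᵥ b i = d • b'' k := by
        intro i
        refine exists_eq_smul_basis_of_eigenvector b'' χ'' hdiag'' hdist'' ?_
          fun x hx => hAgdiag g x (Subgroup.mem_inf.1 hx).2 i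
        intro h0
        apply b.ne_zero i
        refine toLin'_units_injective g ?_
        rw [Matrix.toLin'_apply, Matrix.toLin'_apply, h0, Matrix.mulVec_zero]
      choose π d hπ using h1
      have hd0 : ∀ i, d i ≠ 0 := fun i h0 => b.ne_zero i (by rw [hπ i, h0, zero_smul])
      have hπinj : Function.Injective π := by
        intro i i' hii'
        have e : d i' • b i = d i • b i' := by
          rw [hπ i, hπ i', smul_smul, smul_smul, hii', mul_comm]
        exact MonomialAdequacy.basis_index_eq_of_smul_eq b e (hd0 i')
      have hπsurj : Function.Surjective π := Finite.surjective_of_injective hπinj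
      intro i
      obtain ⟨k, d', hk⟩ := h2 i
      obtain ⟨i₁, rfl⟩ := hπsurj k
      refine ⟨i₁, d' * (d i₁)⁻¹, ?_⟩
      rw [hk, hπ i₁, smul_smul, mul_assoc, inv_mul_cancel₀ (hd0 i₁), mul_one]
  by_cases hall : ∀ g ∈ H, ∀ i, ∃ (j : Fin p) (d : K), ((g : GL (Fin p) K) : Matrix (Fin p) (Fin p) K) *ᵥ b i = d • b j
  · -- every element of `H` permutes the lines: `A` is central in `H`, hence scalar
    obtain ⟨θH, hθH⟩ := MonomialAdequacy.exists_permHom_of_lines (H := H) b fun h i => hall h h.2 i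
    have hker : (⟨a, hLH a.2⟩ : H) ∈ θH.ker := by
      rw [MonoidHom.mem_ker]
      refine Equiv.ext fun i => ?_
      obtain ⟨d, hd, hd0⟩ := hAdiag a haA i
      obtain ⟨d', hd'⟩ := hθH ⟨a, hLH a.2⟩ i
      have e : d • b i = d' • b (θH ⟨a, hLH a.2⟩ i) := hd.symm.trans hd'
      rw [Equiv.Perm.coe_one, id]
      exact (MonomialAdequacy.basis_index_eq_of_smul_eq b e hd0).symm
    obtain ⟨e, he⟩ := exists_eq_smul_one_of_mem_center hirrH (hmono b θH hθH hker)
    exact hans e he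
  · push Not at hall
    obtain ⟨g, hg, hng⟩ := hall
    have hQ : ∀ x ∈ A ⊓ Ag g, ∃ e : K, ((x : GL (Fin p) K) : Matrix (Fin p) (Fin p) K) = e • 1 :=
      (hPQ g hg).resolve_left fun h => by
        obtain ⟨i, hi⟩ := hng
        obtain ⟨j, d, hjd⟩ := h i
        exact hi j d hjd
    -- the image of `gAg⁻¹` in the transitive group `θ(L) ≤ S_p`
    let B : Subgroup (Equiv.Perm (Fin p)) := ((Ag g).subgroupOf L).map θ
    have hmemB : ∀ s, s ∈ B ↔ ∃ z : L, (z : GL (Fin p) K) ∈ Ag g ∧ θ z = s := by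
      intro s
      simp only [B, Subgroup.mem_map, Subgroup.mem_subgroupOf]
    have hBnorm : ∀ t ∈ θ.range, ∀ s ∈ B, t * s * t⁻¹ ∈ B := by
      rintro _ ⟨y, rfl⟩ s hs
      obtain ⟨z, hz, rfl⟩ := (hmemB s).1 hs
      refine (hmemB _).2 ⟨y * z * y⁻¹, ?_, by rw [map_mul, map_mul, map_inv]⟩
      exact hAgnormL g hg y y.2 z hz
    have hBcomm : ∀ s ∈ B, ∀ s' ∈ B, s * s' = s' * s := by
      intro s hs s' hs'
      obtain ⟨z, hz, rfl⟩ := (hmemB s).1 hs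
      obtain ⟨z', hz', rfl⟩ := (hmemB s').1 hs'
      rw [← map_mul, ← map_mul]
      congr 1
      exact Subtype.ext (hAgcomm g z hz z' hz')
    have hTtrans : ∀ i j : Fin p, ∃ t ∈ θ.range, t i = j := fun i j => by
      obtain ⟨y, hy⟩ := MonomialAdequacy.monomial_transitive b θ c hc hirrL i j
      exact ⟨θ y, ⟨y, rfl⟩, hy⟩
    rcases eq_bot_or_card_eq_of_comm_of_transitive hBnorm hBcomm hTtrans with hB | hB
    · -- `θ(gAg⁻¹) = 1`: then `gAg⁻¹ ≤ A`, so `gAg⁻¹ = A` is scalar on `A ∩ gAg⁻¹ = A`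
      have hle : Ag g ≤ A := by
        intro x hx
        have hxL : x ∈ L := hAgL g hg hx
        have hθx : θ ⟨x, hxL⟩ ∈ B := (hmemB _).2 ⟨⟨x, hxL⟩, hx, rfl⟩
        rw [hB, Subgroup.mem_bot] at hθx
        exact (hAker ⟨x, hxL⟩).2 hθx
      haveI : Finite A := Finite.of_injective _ (Subgroup.inclusion_injective hAL)
      have heq : Ag g = A := Subgroup.eq_of_le_of_card_ge hle (hAgcard g).symm.le
      obtain ⟨e, he⟩ := hQ a (Subgroup.mem_inf.2 ⟨haA, heq ▸ haA⟩)
      exact hans e he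
    · -- `|θ(gAg⁻¹)| = p` divides `|A|`, a `p'`-group
      apply hAcard
      have h1 : Nat.card B ∣ Nat.card ((Ag g).subgroupOf L) := Subgroup.card_map_dvd _ θ
      have h2 : Nat.card ((Ag g).subgroupOf L) = Nat.card A := by
        rw [Nat.card_congr (Subgroup.subgroupOfEquivOfLe (hAgL g hg)).toEquiv, hAgcard g]
      rw [hB, h2] at h1
      exact h1

end LinesNormal

/-! ### The quasisimple layer of a primitive group of prime degree -/

section Structure

variable {p : ℕ} [hp : Fact p.Prime] [CharP K p] [IsAlgClosed K]


omit hp [CharP K p] [IsAlgClosed K] in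
/-- An element acting diagonally along `b` fixes every line of a line structure on `b`.
[folklore] -/
theorem perm_eq_one_of_diag {H : Subgroup (GL (Fin p) K)} (b : Module.Basis (Fin p) K (Fin p → K))
    (θ : ↥H →* Equiv.Perm (Fin p))
    (hθ : ∀ (h : H) (i : Fin p), ∃ c : K, ((h : GL (Fin p) K) : Matrix (Fin p) (Fin p) K) *ᵥ b i = c • b (θ h i))
    (y : H) (hdiag : ∀ i, ∃ d : K, ((y : GL (Fin p) K) : Matrix (Fin p) (Fin p) K) *ᵥ b i = d • b i) : θ y = 1 := by
  refine Equiv.ext fun i => ?_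
  obtain ⟨d, hd⟩ := hdiag i
  have hd0 : d ≠ 0 := by
    intro h0
    apply b.ne_zero i
    refine toLin'_units_injective (y : GL (Fin p) K) ?_
    rw [Matrix.toLin'_apply, Matrix.toLin'_apply, hd, h0, zero_smul, Matrix.mulVec_zero]
  obtain ⟨d', hd'⟩ := hθ y i
  have e : d • b i = d' • b (θ y i) := hd.symm.trans hd'
  rw [Equiv.Perm.coe_one, id]
  exact (MonomialAdequacy.basis_index_eq_of_smul_eq b e hd0).symm

omit [CharP K p] in
/-- In a primitive irreducible `H ≤ GL_p(K)`, an `H`-normalised subgroup is scalar or irreducible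
(Clifford, and primitivity for the line alternative). [folklore] -/
theorem scalar_or_isIrreducible_of_primitive {H N : Subgroup (GL (Fin p) K)} [Finite H]
    (hirrH : (glRepresentation H.subtype).IsIrreducible)
    (hmono : ∀ (b : Module.Basis (Fin p) K (Fin p → K)) (θ : ↥H →* Equiv.Perm (Fin p)),
      (∀ (h : H) (i : Fin p), ∃ c : K, ((h : GL (Fin p) K) : Matrix (Fin p) (Fin p) K) *ᵥ b i = c • b (θ h i)) →
      θ.ker ≤ Subgroup.center H)
    (hNH : N ≤ H) (hnorm : ∀ h ∈ H, ∀ x ∈ N, h * x * h⁻¹ ∈ N) :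
    (∀ x ∈ N, ∃ c : K, ((x : GL (Fin p) K) : Matrix (Fin p) (Fin p) K) = c • 1) ∨
      (glRepresentation N.subtype).IsIrreducible := by
  rcases clifford hirrH hnorm with h | h | ⟨b, χ, hperm, hdiag, -⟩
  · exact Or.inr h
  · exact Or.inl h
  · left
    obtain ⟨θ, hθ⟩ := MonomialAdequacy.exists_permHom_of_lines (H := H) b fun h i => hperm h h.2 i
    have hker := hmono b θ hθ
    intro x hx
    have hxker : (⟨x, hNH hx⟩ : H) ∈ θ.ker :=
      perm_eq_one_of_diag b θ hθ ⟨x, hNH hx⟩ fun i => ⟨χ x i, hdiag x hx i⟩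
    exact exists_eq_smul_one_of_mem_center hirrH (hker hxker)

omit hp [CharP K p] [IsAlgClosed K] in
/-- Scalars commute with everything (in `GL_p`). [folklore] -/
theorem mul_comm_of_scalar {z : GL (Fin p) K} (hz : ∃ c : K, ((z : GL (Fin p) K) : Matrix (Fin p) (Fin p) K) = c • 1)
    (y : GL (Fin p) K) : z * y = y * z := by
  obtain ⟨c, hc⟩ := hz
  apply Units.ext
  rw [Units.val_mul, Units.val_mul, hc, Matrix.smul_mul, Matrix.mul_smul, Matrix.one_mul,
    Matrix.mul_one]

omit hp [CharP K p] [IsAlgClosed K] in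
/-- Conjugates of scalars are scalars. [folklore] -/
theorem scalar_conj_iff (g x : GL (Fin p) K) :
    (∃ c : K, (((g * x * g⁻¹ : GL (Fin p) K)) : Matrix (Fin p) (Fin p) K) = c • 1) ↔
      ∃ c : K, ((x : GL (Fin p) K) : Matrix (Fin p) (Fin p) K) = c • 1 := by
  constructor
  · rintro ⟨c, hc⟩
    refine ⟨c, ?_⟩
    have e : x = g⁻¹ * (g * x * g⁻¹) * g := by group
    rw [e, Units.val_mul, Units.val_mul, hc, Matrix.mul_smul, Matrix.mul_one, Matrix.smul_mul,
      ← Units.val_mul, inv_mul_cancel, Units.val_one]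
  · rintro ⟨c, hc⟩
    refine ⟨c, ?_⟩
    rw [Units.val_mul, Units.val_mul, hc, Matrix.mul_smul, Matrix.mul_one, Matrix.smul_mul,
      ← Units.val_mul, mul_inv_cancel, Units.val_one]

omit [IsAlgClosed K] in
/-- `λ`-twisted commutation forces `λ = 1` in degree `p = char K`: if `y x y⁻¹ x⁻¹` is the scalar
`λ`, then `det` gives `λᵖ = 1`, i.e. `(λ - 1)ᵖ = 0`. [folklore] -/
theorem commute_of_commutator_scalar {x y : GL (Fin p) K}
    (h : ∃ c : K, (((y * x * y⁻¹ * x⁻¹ : GL (Fin p) K)) : Matrix (Fin p) (Fin p) K) = c • 1) :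
    ((y : GL (Fin p) K) : Matrix (Fin p) (Fin p) K) * x = x * y := by
  obtain ⟨lam, hlam⟩ := h
  have hyx : (((y * x * y⁻¹ : GL (Fin p) K)) : Matrix (Fin p) (Fin p) K) = lam • ((x : GL (Fin p) K) : Matrix (Fin p) (Fin p) K) := by
    have e : y * x * y⁻¹ = (y * x * y⁻¹ * x⁻¹) * x := by group
    rw [e, Units.val_mul, hlam, Matrix.smul_mul, Matrix.one_mul]
  have hdet : Matrix.det ((((y * x * y⁻¹ : GL (Fin p) K)) : Matrix (Fin p) (Fin p) K)) = Matrix.det ((x : GL (Fin p) K) : Matrix (Fin p) (Fin p) K) := by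
    rw [Units.val_mul, Units.val_mul]
    exact Matrix.det_units_conj y _
  rw [hyx, Matrix.det_smul, Fintype.card_fin] at hdet
  have hdx : Matrix.det ((x : GL (Fin p) K) : Matrix (Fin p) (Fin p) K) ≠ 0 := (Matrix.isUnits_det_units x).ne_zero
  have hlp : lam ^ p = 1 := (mul_eq_right₀ hdx).1 hdet
  have hl1 : lam = 1 := by
    have h1 : (lam - 1) ^ p = 0 := by rw [sub_pow_char, hlp, one_pow, sub_self]
    exact sub_eq_zero.1 ((pow_eq_zero_iff hp.out.ne_zero).1 h1)
  rw [hl1, one_smul, Units.val_mul, Units.val_mul] at hyx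
  have e : (y : GL (Fin p) K) * x = (y * x * y⁻¹) * y := by group
  rw [← Units.val_mul, e, Units.val_mul, Units.val_mul, Units.val_mul, hyx]

/-- **Primitive irreducible linear groups of prime degree `p` in characteristic `p` are almost
quasisimple** (the structural half of GHT Prop. 6.5 (ii), classification-free).  Let `K = K̄` have
characteristic `p` and let `H ≤ GL_p(K)` be finite, irreducible and primitive (every
line-permutation structure has central kernel).  Then `H` normalises a subgroup `L ≤ H` which is
irreducible on `Kᵖ`, perfect, and such that `L/Z(L)` is a simple group (non-abelian, as `L` is
irreducible of prime degree): `L` is quasisimple, `C_H(L)` consists of scalars (Schur), so `H/Z(H)`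
embeds in `Aut(L/Z(L))`.  Proof: `L` is an `H`-normalised non-scalar subgroup of least order; it is
irreducible (Clifford + primitivity); `⁅L, L⁆` is `H`-normalised, so it is `L` or scalar, and in
the latter case `⟨x, L ∩ Z⟩` (`x ∈ L` non-scalar) would be an abelian normal subgroup of `L` with a
line structure of non-scalar kernel (`false_of_lines_of_normal`); finally a normal subgroup `M` of
`L` containing `Z(L)` is scalar, or has such a line structure (impossible), or is irreducible — and
then, unless `M = L`, some `M ∩ hMh⁻¹` is strictly smaller, hence scalar by induction, so `hMh⁻¹`
commutes with `M` up to scalars of `p`-th power `1`, i.e. centralises the irreducible `M`, and is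
scalar itself. [cite: GuralnickHerzigTiep2017, Proposition 6.5 (ii) (statement "G almost
quasisimple, H = G^(∞) quasisimple irreducible"; our proof avoids [GT3] and [Zie])] -/
theorem exists_quasisimple_normal_of_primitive {H : Subgroup (GL (Fin p) K)} [Finite H]
    (hirrH : (glRepresentation H.subtype).IsIrreducible)
    (hmono : ∀ (b : Module.Basis (Fin p) K (Fin p → K)) (θ : ↥H →* Equiv.Perm (Fin p)),
      (∀ (h : H) (i : Fin p), ∃ c : K, ((h : GL (Fin p) K) : Matrix (Fin p) (Fin p) K) *ᵥ b i = c • b (θ h i)) →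
      θ.ker ≤ Subgroup.center H) :
    ∃ L : Subgroup (GL (Fin p) K), L ≤ H ∧ (∀ h ∈ H, ∀ x ∈ L, h * x * h⁻¹ ∈ L) ∧
      (glRepresentation L.subtype).IsIrreducible ∧ ⁅L, L⁆ = L ∧
      IsSimpleGroup (L ⧸ Subgroup.center L) := by
  classical
  -- `L`: an `H`-normalised non-scalar subgroup of `H` of least order
  let good : Subgroup (GL (Fin p) K) → Prop := fun N =>
    N ≤ H ∧ (∀ h ∈ H, ∀ x ∈ N, h * x * h⁻¹ ∈ N) ∧ ∃ x ∈ N, ∀ c : K, ((x : GL (Fin p) K) : Matrix (Fin p) (Fin p) K) ≠ c • 1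
  have hHgood : good H :=
    ⟨le_rfl, fun h hh x hx => H.mul_mem (H.mul_mem hh hx) (H.inv_mem hh),
      exists_not_scalar_of_isIrreducible hirrH⟩
  have hex : ∃ m, ∃ N, good N ∧ Nat.card N = m := ⟨_, H, hHgood, rfl⟩
  obtain ⟨L, hLgood, hLcard⟩ := Nat.find_spec hex
  have hmin : ∀ N, good N → Nat.card L ≤ Nat.card N := fun N hN => by
    rw [hLcard]
    exact Nat.find_min' hex ⟨N, hN, rfl⟩
  obtain ⟨hLH, hLnorm, hLns⟩ := hLgood
  haveI : Finite L := Finite.of_injective _ (Subgroup.inclusion_injective hLH)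
  have hLnorm' : ∀ h ∈ H, ∀ x ∈ L, h⁻¹ * x * h ∈ L := fun h hh x hx => by
    simpa only [inv_inv] using hLnorm h⁻¹ (H.inv_mem hh) x hx
  have hLmin : ∀ N : Subgroup (GL (Fin p) K), N ≤ L → (∀ h ∈ H, ∀ x ∈ N, h * x * h⁻¹ ∈ N) →
      (∀ x ∈ N, ∃ c : K, ((x : GL (Fin p) K) : Matrix (Fin p) (Fin p) K) = c • 1) ∨ N = L := by
    intro N hNL hNnorm
    by_cases hsc : ∀ x ∈ N, ∃ c : K, ((x : GL (Fin p) K) : Matrix (Fin p) (Fin p) K) = c • 1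
    · exact Or.inl hsc
    right
    push Not at hsc
    exact Subgroup.eq_of_le_of_card_ge hNL (hmin N ⟨hNL.trans hLH, hNnorm, hsc⟩)
  -- `L` is irreducible
  have hirrL : (glRepresentation L.subtype).IsIrreducible := by
    rcases scalar_or_isIrreducible_of_primitive hirrH hmono hLH hLnorm with h | h
    · obtain ⟨x, hx, hxns⟩ := hLns
      obtain ⟨c, hc⟩ := h x hx
      exact (hxns c hc).elim
    · exact h
  -- `L` is perfect
  have hperf : ⁅L, L⁆ = L := by
    have hDL : ⁅L, L⁆ ≤ L := Subgroup.commutator_le.2 fun x hx y hy => by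
      rw [commutatorElement_def]
      exact L.mul_mem (L.mul_mem (L.mul_mem hx hy) (L.inv_mem hx)) (L.inv_mem hy)
    have hDnorm : ∀ h ∈ H, ∀ x ∈ ⁅L, L⁆, h * x * h⁻¹ ∈ ⁅L, L⁆ := by
      intro h hh x hx
      have hmapL : L.map (MulAut.conj h).toMonoidHom ≤ L := by
        rintro _ ⟨y, hy, rfl⟩
        exact hLnorm h hh y hy
      have hle : (⁅L, L⁆).map (MulAut.conj h).toMonoidHom ≤ ⁅L, L⁆ := by
        rw [Subgroup.map_commutator]
        exact Subgroup.commutator_mono hmapL hmapL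
      exact hle ⟨x, hx, rfl⟩
    rcases hLmin _ hDL hDnorm with hsc | h
    · exfalso
      obtain ⟨x, hxL, hxns⟩ := hLns
      -- `A_x = ⟨x, L ∩ Z⟩`, an abelian `L`-normal subgroup
      let S : Set (GL (Fin p) K) :=
        insert x {z | z ∈ L ∧ ∃ c : K, ((z : GL (Fin p) K) : Matrix (Fin p) (Fin p) K) = c • 1}
      have hSL : S ⊆ L := by
        rintro z (rfl | ⟨hz, -⟩)
        exacts [hxL, hz]
      have hScomm : ∀ z ∈ S, ∀ z' ∈ S, z * z' = z' * z := by
        rintro z (rfl | ⟨-, hz⟩) z' (rfl | ⟨-, hz'⟩)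
        · rfl
        · exact (mul_comm_of_scalar hz' z).symm
        · exact mul_comm_of_scalar hz z'
        · exact mul_comm_of_scalar hz z'
      have hAxcomm : ∀ z ∈ Subgroup.closure S, ∀ z' ∈ Subgroup.closure S, z * z' = z' * z := by
        intro z hz z' hz'
        exact congrArg Subtype.val
          ((Subgroup.isMulCommutative_closure hScomm).is_comm.comm (⟨z, hz⟩ : Subgroup.closure S)
            ⟨z', hz'⟩)
      have hAxnorm : ∀ y ∈ L, ∀ z ∈ Subgroup.closure S, y * z * y⁻¹ ∈ Subgroup.closure S := by
        intro y hy z hz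
        have hle : (Subgroup.closure S).map (MulAut.conj y).toMonoidHom ≤ Subgroup.closure S := by
          rw [MonoidHom.map_closure]
          refine (Subgroup.closure_le _).2 ?_
          rintro _ ⟨z, hz, rfl⟩
          rw [MulEquiv.coe_toMonoidHom, MulAut.conj_apply]
          rcases hz with rfl | ⟨hzL, hzc⟩
          · have hcm : y * z * y⁻¹ * z⁻¹ ∈ ⁅L, L⁆ := by
              have h0 := Subgroup.commutator_mem_commutator hy hxL
              rwa [commutatorElement_def] at h0
            have h1 : y * z * y⁻¹ * z⁻¹ ∈ Subgroup.closure S :=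
              Subgroup.subset_closure (Set.mem_insert_of_mem _ ⟨hDL hcm, hsc _ hcm⟩)
            have h2 : z ∈ Subgroup.closure S := Subgroup.subset_closure (Set.mem_insert _ _)
            have e : y * z * y⁻¹ = (y * z * y⁻¹ * z⁻¹) * z := by group
            rw [e]
            exact (Subgroup.closure S).mul_mem h1 h2
          · have e : y * z * y⁻¹ = z := by
              rw [← mul_comm_of_scalar hzc y, mul_assoc, mul_inv_cancel, mul_one]
            rw [e]
            exact Subgroup.subset_closure (Set.mem_insert_of_mem _ ⟨hzL, hzc⟩)
        exact hle ⟨z, hz, rfl⟩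
      have hxA : x ∈ Subgroup.closure S := Subgroup.subset_closure (Set.mem_insert _ _)
      rcases clifford (H := L) (N := Subgroup.closure S) hirrL hAxnorm with h1 | h2 |
          ⟨b, χ, hperm, hdiag, -⟩
      · exact not_isIrreducible_of_comm hAxcomm h1
      · obtain ⟨c, hc⟩ := h2 x hxA
        exact hxns c hc
      · obtain ⟨θ, hθ⟩ :=
          MonomialAdequacy.exists_permHom_of_lines (H := L) b fun h i => hperm h h.2 i
        have hθx : θ ⟨x, hxL⟩ = 1 :=
          perm_eq_one_of_diag b θ hθ ⟨x, hxL⟩ fun i => ⟨χ x i, hdiag x hxA i⟩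
        exact false_of_lines_of_normal hirrH hmono hLH hLnorm hirrL b θ hθ hθx hxns
    · exact h
  -- normal subgroups of `L`: scalar or everything
  have hclaim : ∀ (n : ℕ) (M : Subgroup (GL (Fin p) K)), Nat.card M = n → M ≤ L →
      (∀ y ∈ L, ∀ x ∈ M, y * x * y⁻¹ ∈ M) →
      (∀ x ∈ M, ∃ c : K, ((x : GL (Fin p) K) : Matrix (Fin p) (Fin p) K) = c • 1) ∨ M = L := by
    intro n
    induction n using Nat.strong_induction_on with
    | _ n ih =>
    intro M hMn hML hMnorm
    by_cases hsc : ∀ x ∈ M, ∃ c : K, ((x : GL (Fin p) K) : Matrix (Fin p) (Fin p) K) = c • 1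
    · exact Or.inl hsc
    right
    push Not at hsc
    obtain ⟨x₁, hx₁M, hx₁ns⟩ := hsc
    haveI : Finite M := Finite.of_injective _ (Subgroup.inclusion_injective hML)
    rcases clifford (H := L) (N := M) hirrL hMnorm with hirrM | hscM | ⟨b, χ, hperm, hdiag, -⟩
    · -- `M` irreducible
      by_contra hML'
      let Mc : GL (Fin p) K → Subgroup (GL (Fin p) K) := fun g => M.map (MulAut.conj g).toMonoidHom
      have hmemMc : ∀ g x, x ∈ Mc g ↔ ∃ x₀ ∈ M, g * x₀ * g⁻¹ = x := by
        intro g x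
        simp only [Mc, Subgroup.mem_map, MulEquiv.coe_toMonoidHom, MulAut.conj_apply]
      have hMcL : ∀ g ∈ H, Mc g ≤ L := by
        intro g hg x hx
        obtain ⟨x₀, hx₀, rfl⟩ := (hmemMc _ x).1 hx
        exact hLnorm _ hg x₀ (hML hx₀)
      have hMcnorm : ∀ g ∈ H, ∀ y ∈ L, ∀ x ∈ Mc g, y * x * y⁻¹ ∈ Mc g := by
        intro g hg y hy x hx
        obtain ⟨x₀, hx₀, rfl⟩ := (hmemMc _ x).1 hx
        exact (hmemMc _ _).2 ⟨(g⁻¹ * y * g) * x₀ * (g⁻¹ * y * g)⁻¹,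
          hMnorm _ (hLnorm' _ hg y hy) x₀ hx₀, by group⟩
      -- the core `M₀ = M ∩ ⋂ₕ hMh⁻¹` is `H`-normalised
      let M₀ : Subgroup (GL (Fin p) K) := M ⊓ ⨅ h : H, Mc (h : GL (Fin p) K)
      have hmemM₀ : ∀ x, x ∈ M₀ ↔ x ∈ M ∧ ∀ h : H, x ∈ Mc (h : GL (Fin p) K) := by
        intro x
        simp only [M₀, Subgroup.mem_inf, Subgroup.mem_iInf]
      have hM₀M : M₀ ≤ M := inf_le_left
      have hM₀norm : ∀ g ∈ H, ∀ x ∈ M₀, g * x * g⁻¹ ∈ M₀ := by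
        intro g hg x hx
        rw [hmemM₀] at hx ⊢
        obtain ⟨-, hxc⟩ := hx
        constructor
        · obtain ⟨x₀, hx₀, hx₀e⟩ := (hmemMc _ x).1 (hxc ⟨g⁻¹, H.inv_mem hg⟩)
          have e : g * x * g⁻¹ = x₀ := by
            rw [← hx₀e]
            group
          rw [e]
          exact hx₀
        · intro h
          obtain ⟨x₀, hx₀, hx₀e⟩ := (hmemMc _ x).1 (hxc (⟨g, hg⟩⁻¹ * h))
          refine (hmemMc _ _).2 ⟨x₀, hx₀, ?_⟩
          rw [← hx₀e, Subgroup.coe_mul, Subgroup.coe_inv]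
          group
      rcases hLmin M₀ (hM₀M.trans hML) hM₀norm with hM₀sc | hM₀L
      · -- some conjugate `hMh⁻¹` does not contain `M`
        have hexh : ∃ h : H, ¬ (M ≤ Mc (h : GL (Fin p) K)) := by
          by_contra hall
          push Not at hall
          have hx₁ : x₁ ∈ M₀ := (hmemM₀ x₁).2 ⟨hx₁M, fun h => hall h hx₁M⟩
          obtain ⟨c, hc⟩ := hM₀sc x₁ hx₁
          exact hx₁ns c hc
        obtain ⟨h, hh⟩ := hexh
        have hM₂norm : ∀ y ∈ L, ∀ x ∈ M ⊓ Mc (h : GL (Fin p) K),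
            y * x * y⁻¹ ∈ M ⊓ Mc (h : GL (Fin p) K) := fun y hy x hx =>
          Subgroup.mem_inf.2 ⟨hMnorm y hy x (Subgroup.mem_inf.1 hx).1,
            hMcnorm _ h.2 y hy x (Subgroup.mem_inf.1 hx).2⟩
        have hlt : Nat.card ↥(M ⊓ Mc (h : GL (Fin p) K)) < n := by
          rw [← hMn]
          by_contra hge
          push Not at hge
          have heq := Subgroup.eq_of_le_of_card_ge (inf_le_left : M ⊓ Mc (h : GL (Fin p) K) ≤ M) hge
          exact hh (heq ▸ (inf_le_right : M ⊓ Mc (h : GL (Fin p) K) ≤ Mc (h : GL (Fin p) K)))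
        rcases ih _ hlt (M ⊓ Mc (h : GL (Fin p) K)) rfl (inf_le_left.trans hML) hM₂norm with
            h2sc | h2L
        · -- `hMh⁻¹` centralises the irreducible `M`, hence is scalar, hence so is `M`
          have hMcsc : ∀ y ∈ Mc (h : GL (Fin p) K), ∃ c : K, ((y : GL (Fin p) K) : Matrix (Fin p) (Fin p) K) = c • 1 := by
            intro y hy
            refine exists_eq_smul_one_of_forall_commute hirrM fun x hx => ?_
            have hcm : y * x * y⁻¹ * x⁻¹ ∈ M ⊓ Mc (h : GL (Fin p) K) := by
              refine Subgroup.mem_inf.2 ⟨M.mul_mem (hMnorm y (hMcL _ h.2 hy) x hx) (M.inv_mem hx), ?_⟩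
              have h3 := hMcnorm _ h.2 x (hML hx) y⁻¹ ((Mc _).inv_mem hy)
              have e : y * x * y⁻¹ * x⁻¹ = y * (x * y⁻¹ * x⁻¹) := by group
              rw [e]
              exact (Mc _).mul_mem hy h3
            exact (commute_of_commutator_scalar (h2sc _ hcm)).symm
          obtain ⟨c, hc⟩ := hMcsc ((h : GL (Fin p) K) * x₁ * (h : GL (Fin p) K)⁻¹)
            ((hmemMc _ _).2 ⟨x₁, hx₁M, rfl⟩)
          obtain ⟨c', hc'⟩ := (scalar_conj_iff _ _).1 ⟨c, hc⟩
          exact hx₁ns c' hc'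
        · exact hML' (le_antisymm hML (h2L ▸ inf_le_left))
      · exact hML' (le_antisymm hML (hM₀L ▸ hM₀M))
    · obtain ⟨c, hc⟩ := hscM x₁ hx₁M
      exact (hx₁ns c hc).elim
    · exfalso
      obtain ⟨θ, hθ⟩ :=
        MonomialAdequacy.exists_permHom_of_lines (H := L) b fun h i => hperm h h.2 i
      have hθx : θ ⟨x₁, hML hx₁M⟩ = 1 :=
        perm_eq_one_of_diag b θ hθ ⟨x₁, hML hx₁M⟩ fun i => ⟨χ x₁ i, hdiag x₁ hx₁M i⟩
      exact false_of_lines_of_normal hirrH hmono hLH hLnorm hirrL b θ hθ hθx hx₁ns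
  -- the centre of `L` is its subgroup of scalars
  have hcenter : ∀ z : L, z ∈ Subgroup.center L ↔
      ∃ c : K, (((z : L) : GL (Fin p) K) : Matrix (Fin p) (Fin p) K) = c • 1 := by
    intro z
    constructor
    · exact exists_eq_smul_one_of_mem_center hirrL
    · intro hz
      rw [Subgroup.mem_center_iff]
      intro y
      exact Subtype.ext (mul_comm_of_scalar hz (y : GL (Fin p) K)).symm
  -- simplicity of `L / Z(L)`
  refine ⟨L, hLH, hLnorm, hirrL, hperf, ?_⟩
  haveI : Nontrivial (L ⧸ Subgroup.center L) := by
    obtain ⟨x, hx, hxns⟩ := hLns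
    refine ⟨⟨QuotientGroup.mk (⟨x, hx⟩ : L), 1, fun h => ?_⟩⟩
    rw [QuotientGroup.eq_one_iff, hcenter] at h
    obtain ⟨c, hc⟩ := h
    exact hxns c hc
  refine ⟨fun Nq hNq => ?_⟩
  let M' : Subgroup L := Nq.comap (QuotientGroup.mk' (Subgroup.center L))
  let M : Subgroup (GL (Fin p) K) := M'.map L.subtype
  have hmemM : ∀ y : L, (y : GL (Fin p) K) ∈ M ↔ (QuotientGroup.mk y : L ⧸ Subgroup.center L) ∈ Nq := by
    intro y
    constructor
    · rintro ⟨y', hy', hyy'⟩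
      have : y' = y := Subtype.ext hyy'
      subst this
      exact hy'
    · intro hy
      exact ⟨y, hy, rfl⟩
  have hML : M ≤ L := fun x ⟨y, _, hy⟩ => hy ▸ y.2
  have hMnorm : ∀ y ∈ L, ∀ x ∈ M, y * x * y⁻¹ ∈ M := by
    rintro y hy _ ⟨x', hx', rfl⟩
    have e : (((⟨y, hy⟩ * x' * ⟨y, hy⟩⁻¹ : L)) : GL (Fin p) K) = y * x' * y⁻¹ := rfl
    rw [Subgroup.coe_subtype, ← e, hmemM, QuotientGroup.mk_mul, QuotientGroup.mk_mul,
      QuotientGroup.mk_inv]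
    exact hNq.conj_mem _ ((hmemM x').1 ⟨x', hx', rfl⟩) _
  rcases hclaim _ M rfl hML hMnorm with hsc | hMeqL
  · left
    rw [Subgroup.eq_bot_iff_forall]
    intro q hq
    obtain ⟨y, rfl⟩ := QuotientGroup.mk_surjective q
    rw [QuotientGroup.eq_one_iff, hcenter]
    exact hsc _ ((hmemM y).2 hq)
  · right
    rw [eq_top_iff]
    intro q _
    obtain ⟨y, rfl⟩ := QuotientGroup.mk_surjective q
    have hyM : (y : GL (Fin p) K) ∈ M := by
      rw [hMeqL]
      exact y.2
    exact (hmemM y).1 hyM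

end Structure

end PrimeDegreeClifford

/-! ## Topic-level statements -/

section Final

/-- **GHT 2017 Prop. 6.5 (ii), structural half, classification-free.**  For `K = K̄` of
characteristic `p` and a finite irreducible `H ≤ GL_p(K)` all of whose line-permutation structures
have central kernel (the primitive groups, together with the centrally-imprimitive ones), `H`
normalises a subgroup `L ≤ H` that is irreducible on `Kᵖ`, perfect, and has `L/Z(L)` simple:
the quasisimple layer, `H/Z(H) ≤ Aut(L/Z(L))`.  GHT quote [GT3] (Aschbacher's theorem) and [Zie];
the proof here (`PrimeDegreeClifford.exists_quasisimple_normal_of_primitive`) is elementary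
Clifford theory in prime degree.
[cite: GuralnickHerzigTiep2017, Proposition 6.5 (ii)] -/
theorem Subgroup.exists_quasisimple_normal_of_primitive {K : Type u} [Field K] [IsAlgClosed K]
    {p : ℕ} [Fact p.Prime] [CharP K p] {H : Subgroup (GL (Fin p) K)} [Finite H]
    (hirrH : (glRepresentation H.subtype).IsIrreducible)
    (hmono : ∀ (b : Module.Basis (Fin p) K (Fin p → K)) (θ : ↥H →* Equiv.Perm (Fin p)),
      (∀ (h : H) (i : Fin p), ∃ c : K,
        ((h : GL (Fin p) K) : Matrix (Fin p) (Fin p) K) *ᵥ b i = c • b (θ h i)) →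
      θ.ker ≤ Subgroup.center H) :
    ∃ L : Subgroup (GL (Fin p) K), L ≤ H ∧ (∀ h ∈ H, ∀ x ∈ L, h * x * h⁻¹ ∈ L) ∧
      (glRepresentation L.subtype).IsIrreducible ∧ ⁅L, L⁆ = L ∧
      IsSimpleGroup (L ⧸ Subgroup.center L) :=
  PrimeDegreeClifford.exists_quasisimple_normal_of_primitive hirrH hmono

/-- **Alternative (b) of Theorem 1.7 is impossible in the primitive case.**  If `τ : G →* GL_p(K)`
(`K = K̄` of characteristic `p`, `G` finite) is faithful and irreducible and every
line-permutation structure of `τ(G)` has central kernel, then `G` has no abelian normal subgroup of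
index `p`: its image would be scalar or irreducible (`scalar_or_isIrreducible_of_primitive`);
irreducible abelian groups live in dimension `1`, and a scalar normal subgroup of prime index makes
`τ(G)/Z` cyclic, `τ(G)` abelian. [folklore] -/
theorem not_exists_comm_normal_index_of_primitive {K : Type u} [Field K] [IsAlgClosed K]
    {p : ℕ} [Fact p.Prime] [CharP K p] {G : Type v} [Group G] [Finite G]
    (τ : G →* GL (Fin p) K) (hinj : Function.Injective τ)
    (hirr : (glRepresentation τ).IsIrreducible)
    (hmono : ∀ (b : Module.Basis (Fin p) K (Fin p → K)) (θ : ↥τ.range →* Equiv.Perm (Fin p)),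
      (∀ (h : τ.range) (i : Fin p), ∃ c : K,
        ((h : GL (Fin p) K) : Matrix (Fin p) (Fin p) K) *ᵥ b i = c • b (θ h i)) →
      θ.ker ≤ Subgroup.center τ.range) :
    ¬ ∃ A : Subgroup G, A.Normal ∧ (∀ x ∈ A, ∀ y ∈ A, x * y = y * x) ∧ A.index = p := by
  rintro ⟨A, hAn, hAcomm, hAidx⟩
  haveI : Finite τ.range := Finite.of_surjective _ τ.rangeRestrict_surjective
  have hirrH := isIrreducible_range_subtype τ hirr
  have hNH : A.map τ ≤ τ.range := Subgroup.map_le_range τ A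
  have hNnorm : ∀ h ∈ τ.range, ∀ x ∈ A.map τ, h * x * h⁻¹ ∈ A.map τ := by
    rintro _ ⟨g, rfl⟩ _ ⟨a, ha, rfl⟩
    exact ⟨g * a * g⁻¹, hAn.conj_mem a ha g, by rw [map_mul, map_mul, map_inv]⟩
  have hNcomm : ∀ x ∈ A.map τ, ∀ y ∈ A.map τ, x * y = y * x := by
    rintro _ ⟨a, ha, rfl⟩ _ ⟨a', ha', rfl⟩
    rw [← map_mul, hAcomm a ha a' ha', map_mul]
  rcases PrimeDegreeClifford.scalar_or_isIrreducible_of_primitive hirrH hmono hNH hNnorm with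
      hsc | hirrN
  · -- a scalar (central) normal subgroup of prime index: the group is abelian
    let N' : Subgroup τ.range := (A.map τ).subgroupOf τ.range
    haveI hN'n : N'.Normal := ⟨fun x hx g => by
      simp only [N', Subgroup.mem_subgroupOf, Subgroup.coe_mul, Subgroup.coe_inv] at hx ⊢
      exact hNnorm _ g.2 _ hx⟩
    have hN'le : N' ≤ Subgroup.center τ.range := by
      intro x hx
      rw [Subgroup.mem_subgroupOf] at hx
      rw [Subgroup.mem_center_iff]
      intro y
      exact Subtype.ext (PrimeDegreeClifford.mul_comm_of_scalar (hsc _ hx) _).symm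
    have hidx : N'.index = p := by
      have h1 : N'.comap τ.rangeRestrict = A := by
        ext x
        simp only [N', Subgroup.mem_comap, Subgroup.mem_subgroupOf, MonoidHom.coe_rangeRestrict,
          Subgroup.mem_map]
        constructor
        · rintro ⟨a, ha, hax⟩
          exact hinj hax ▸ ha
        · intro hx
          exact ⟨x, hx, rfl⟩
      rw [← Subgroup.index_comap_of_surjective N' τ.rangeRestrict_surjective, h1]
      exact hAidx
    haveI : IsCyclic (τ.range ⧸ N') :=
      isCyclic_of_prime_card (p := p) (by rw [← Subgroup.index_eq_card]; exact hidx)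
    have hcommH : ∀ x ∈ τ.range, ∀ y ∈ τ.range, x * y = y * x := by
      intro x hx y hy
      have h := (MonoidHom.isMulCommutative_of_isCyclic_of_ker_le_center (QuotientGroup.mk' N')
        (by rw [QuotientGroup.ker_mk']; exact hN'le)).is_comm.comm ⟨x, hx⟩ ⟨y, hy⟩
      exact congrArg Subtype.val h
    exact PrimeDegreeClifford.not_isIrreducible_of_comm hcommH hirrH
  · exact PrimeDegreeClifford.not_isIrreducible_of_comm hNcomm hirrN

/-- **What remains of Theorem 1.7 after Prop. 6.6, the case `p = 2`, the `p'`-case and the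
reduction to the quasisimple layer: GHT Thm 2.2 / Props. 6.7–6.14 / Cor. 9.4–9.5.**  The named
fact `ght2017_adequate_or_index_p_or_psl29` follows from: for every ODD prime `p`, `K = K̄` of
characteristic `p`, finite `G` with `p ∣ |G|`, faithful irreducible `τ : G →* GL_p(K)` whose image
is primitive (every line-permutation structure has central kernel) and every `L ≤ τ(G)` normalised
by `τ(G)`, irreducible, perfect, with `L/Z(L)` simple — the quasisimple layer, which EXISTS by
`Subgroup.exists_quasisimple_normal_of_primitive` — alternative (a) (adequate) or (c) (`p = 3`,
image `PSL₂(9) ≅ A₆`) holds.  (Alternative (b) cannot occur for these `τ`.)  This hypothesis is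
exactly the part of the printed proof that identifies `L/Z(L)` by the classification of finite
simple groups (Thm 2.2) and computes `Ext¹` group by group (Props. 6.7–6.14, Cor. 9.4–9.5); it is
NOT in the tree.  (If `p ∤ |G|`, `τ(G)` is adequate by `isExtendedAdequate_range_of_not_dvd_card`.)
[cite: GuralnickHerzigTiep2017, Theorem 6.15 (proof, p. 24), Proposition 6.5 (ii), Theorem 2.2] -/
theorem ght2017_adequate_or_index_p_or_psl29_of_quasisimple_odd
    (hqs : ∀ (p : ℕ) [Fact p.Prime] (K : Type u) [Field K] [IsAlgClosed K] [CharP K p]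
      (G : Type v) [Group G] [Finite G] (τ : G →* GL (Fin p) K),
      p ≠ 2 → Function.Injective τ → (glRepresentation τ).IsIrreducible →
      (∀ (b : Module.Basis (Fin p) K (Fin p → K)) (θ : ↥τ.range →* Equiv.Perm (Fin p)),
        (∀ (h : τ.range) (i : Fin p), ∃ c : K,
          ((h : GL (Fin p) K) : Matrix (Fin p) (Fin p) K) *ᵥ b i = c • b (θ h i)) →
        θ.ker ≤ Subgroup.center τ.range) →
      p ∣ Nat.card G →
      ∀ L : Subgroup (GL (Fin p) K), L ≤ τ.range → (∀ h ∈ τ.range, ∀ x ∈ L, h * x * h⁻¹ ∈ L) →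
        (glRepresentation L.subtype).IsIrreducible → ⁅L, L⁆ = L →
        IsSimpleGroup (L ⧸ Subgroup.center L) →
        Subgroup.IsExtendedAdequate τ.range ∨
          (p = 3 ∧ Nonempty (↥(τ.range.map (QuotientGroup.mk' (Subgroup.center (GL (Fin p) K)))) ≃*
            ↥(alternatingGroup (Fin 6))))) :
    ght2017_adequate_or_index_p_or_psl29.{u, v} := by
  refine ght2017_adequate_or_index_p_or_psl29_of_primitive_odd
    fun p _ K _ _ _ G _ _ τ hp hinj hirr hmono => ?_
  haveI : Finite τ.range := Finite.of_surjective _ τ.rangeRestrict_surjective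
  by_cases hdiv : p ∣ Nat.card G
  · obtain ⟨L, hLH, hLnorm, hirrL, hperf, hsimple⟩ :=
      Subgroup.exists_quasisimple_normal_of_primitive (isIrreducible_range_subtype τ hirr) hmono
    rcases hqs p K G τ hp hinj hirr hmono hdiv L hLH hLnorm hirrL hperf hsimple with h | h
    · exact Or.inl h
    · exact Or.inr (Or.inr h)
  · left
    have hp0 : 0 < p := (Fact.out : p.Prime).pos
    haveI : Representation.IsIrreducible ((glStdRepresentation (Fin p) K).comp τ) := hirr
    have hspan := Literature.RepresentationTheory.Semisimple.span_eq_top_of_isIrreducible τ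
    exact isExtendedAdequate_range_of_not_dvd_card τ hdiv
      ((Literature.RepresentationTheory.Semisimple.span_eq_top_iff_forall_isIrreducible hp0 τ).1
        hspan)

end Final

/-! ## The layer is simple and lies in `SL_p` (appended)

`PrimeDegreeClifford.det_eq_one_of_commutator_eq` (perfect ⇒ `det = 1`),
`PrimeDegreeClifford.eq_one_of_scalar_of_det_eq_one` (`c · 1` with `cᵖ = 1` is `1`),
`Subgroup.exists_simple_normal_of_primitive` (the layer `L` is a SIMPLE group inside `SL_p(K)`,
with scalar centraliser) and `ght2017_adequate_or_index_p_or_psl29_of_simple_odd` (the residual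
hypothesis of Theorem 1.7 stated with a simple layer). -/

namespace PrimeDegreeClifford

variable {K : Type u} [Field K] {p : ℕ} [hp : Fact p.Prime]

omit hp in
/-- A perfect subgroup of `GL_p` lies in `SL_p`: commutators have determinant `1`. [folklore] -/
theorem det_eq_one_of_commutator_eq {L : Subgroup (GL (Fin p) K)} (hperf : ⁅L, L⁆ = L) {x : GL (Fin p) K}
    (hx : x ∈ L) : Matrix.det ((x : GL (Fin p) K) : Matrix (Fin p) (Fin p) K) = 1 := by
  have hle : ⁅L, L⁆ ≤ (Matrix.GeneralLinearGroup.det : GL (Fin p) K →* Kˣ).ker := by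
    refine Subgroup.commutator_le.2 fun a _ b _ => ?_
    rw [MonoidHom.mem_ker, commutatorElement_def, map_mul, map_mul, map_mul, map_inv, map_inv,
      mul_inv_cancel_comm, mul_inv_cancel]
  have h := hle (hperf.symm ▸ hx)
  rw [MonoidHom.mem_ker] at h
  have h' := congrArg (fun u : Kˣ => (u : K)) h
  simpa only [Matrix.GeneralLinearGroup.val_det_apply, Units.val_one] using h'

/-- A scalar matrix of determinant `1` in `GL_p`, `p = char K`, is the identity (`cᵖ = 1` forces
`c = 1`). [folklore] -/
theorem eq_one_of_scalar_of_det_eq_one [CharP K p] {x : GL (Fin p) K}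
    (hsc : ∃ c : K, ((x : GL (Fin p) K) : Matrix (Fin p) (Fin p) K) = c • 1)
    (hdet : Matrix.det ((x : GL (Fin p) K) : Matrix (Fin p) (Fin p) K) = 1) : x = 1 := by
  obtain ⟨c, hc⟩ := hsc
  rw [hc, Matrix.det_smul, Matrix.det_one, mul_one, Fintype.card_fin] at hdet
  have hc1 : c = 1 := by
    have h1 : (c - 1) ^ p = 0 := by rw [sub_pow_char, hdet, one_pow, sub_self]
    exact sub_eq_zero.1 ((pow_eq_zero_iff hp.out.ne_zero).1 h1)
  apply Units.ext
  rw [hc, hc1, one_smul, Units.val_one]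

/-- **The quasisimple layer is simple and unimodular.**  In the situation of
`exists_quasisimple_normal_of_primitive` the subgroup `L` lies in `SL_p(K)` (it is perfect), so
its scalars `c · 1` have `cᵖ = 1`, `c = 1`: `Z(L) = 1` and `L ≅ L/Z(L)` is a (non-abelian) simple
group; the centraliser of `L` in `H` consists of scalars (Schur). [folklore] -/
theorem exists_simple_normal_of_primitive [CharP K p] [IsAlgClosed K] {H : Subgroup (GL (Fin p) K)}
    [Finite H] (hirrH : (glRepresentation H.subtype).IsIrreducible)
    (hmono : ∀ (b : Module.Basis (Fin p) K (Fin p → K)) (θ : ↥H →* Equiv.Perm (Fin p)),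
      (∀ (h : H) (i : Fin p), ∃ c : K,
        ((h : GL (Fin p) K) : Matrix (Fin p) (Fin p) K) *ᵥ b i = c • b (θ h i)) →
      θ.ker ≤ Subgroup.center H) :
    ∃ L : Subgroup (GL (Fin p) K), L ≤ H ∧ (∀ h ∈ H, ∀ x ∈ L, h * x * h⁻¹ ∈ L) ∧
      (glRepresentation L.subtype).IsIrreducible ∧ ⁅L, L⁆ = L ∧ IsSimpleGroup L ∧
      (∀ x ∈ L, Matrix.det ((x : GL (Fin p) K) : Matrix (Fin p) (Fin p) K) = 1) ∧
      (∀ g ∈ H, (∀ x ∈ L, g * x * g⁻¹ = x) →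
        ∃ c : K, ((g : GL (Fin p) K) : Matrix (Fin p) (Fin p) K) = c • 1) := by
  obtain ⟨L, hLH, hLnorm, hirrL, hperf, hsimple⟩ :=
    exists_quasisimple_normal_of_primitive hirrH hmono
  have hdet : ∀ x ∈ L, Matrix.det ((x : GL (Fin p) K) : Matrix (Fin p) (Fin p) K) = 1 :=
    fun x hx => det_eq_one_of_commutator_eq hperf hx
  -- the centre of `L` is trivial
  have hcenter : Subgroup.center L = ⊥ := by
    rw [Subgroup.eq_bot_iff_forall]
    intro z hz
    have hsc := exists_eq_smul_one_of_mem_center hirrL hz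
    exact Subtype.ext (eq_one_of_scalar_of_det_eq_one hsc (hdet _ z.2))
  -- transport simplicity along `L / 1 ≃ L`
  let e : L ⧸ Subgroup.center L ≃* L :=
    (QuotientGroup.quotientMulEquivOfEq hcenter).trans QuotientGroup.quotientBot
  haveI := hsimple
  haveI : Nontrivial L := e.toEquiv.symm.nontrivial
  have hsimpleL : IsSimpleGroup L :=
    IsSimpleGroup.isSimpleGroup_of_surjective e.toMonoidHom e.surjective
  refine ⟨L, hLH, hLnorm, hirrL, hperf, hsimpleL, hdet, fun g hg hcomm => ?_⟩
  refine exists_eq_smul_one_of_forall_commute hirrL fun x hx => ?_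
  have h := hcomm x hx
  have e1 : g * x = x * g := by
    calc g * x = g * x * g⁻¹ * g := by group
      _ = x * g := by rw [h]
  have e2 := congrArg (fun u : GL (Fin p) K => (u : Matrix (Fin p) (Fin p) K)) e1
  simpa only [Units.val_mul] using e2.symm

end PrimeDegreeClifford

section Layer

/-- **The layer of a primitive group of prime degree is a simple subgroup of `SL_p`** (sharpening
of `Subgroup.exists_quasisimple_normal_of_primitive`): for `K = K̄` of characteristic `p` and a
finite irreducible `H ≤ GL_p(K)` all of whose line-permutation structures have central kernel,
there is `L ≤ H`, normalised by `H`, irreducible on `Kᵖ`, perfect, SIMPLE (non-abelian) as an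
abstract group, contained in `SL_p(K)`, whose centraliser in `H` consists of scalars — so that
`H/Z(H)` embeds in `Aut(L)` with `L` simple: "`G` is almost quasisimple" with a simple layer.
(Perfect ⇒ `det = 1`; a scalar `c · 1` of determinant `cᵖ = 1` has `c = 1` in characteristic `p`,
so `Z(L) = 1`.) [cite: GuralnickHerzigTiep2017, Proposition 6.5 (ii)] -/
theorem Subgroup.exists_simple_normal_of_primitive {K : Type u} [Field K] [IsAlgClosed K]
    {p : ℕ} [Fact p.Prime] [CharP K p] {H : Subgroup (GL (Fin p) K)} [Finite H]
    (hirrH : (glRepresentation H.subtype).IsIrreducible)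
    (hmono : ∀ (b : Module.Basis (Fin p) K (Fin p → K)) (θ : ↥H →* Equiv.Perm (Fin p)),
      (∀ (h : H) (i : Fin p), ∃ c : K,
        ((h : GL (Fin p) K) : Matrix (Fin p) (Fin p) K) *ᵥ b i = c • b (θ h i)) →
      θ.ker ≤ Subgroup.center H) :
    ∃ L : Subgroup (GL (Fin p) K), L ≤ H ∧ (∀ h ∈ H, ∀ x ∈ L, h * x * h⁻¹ ∈ L) ∧
      (glRepresentation L.subtype).IsIrreducible ∧ ⁅L, L⁆ = L ∧ IsSimpleGroup L ∧
      (∀ x ∈ L, Matrix.det ((x : GL (Fin p) K) : Matrix (Fin p) (Fin p) K) = 1) ∧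
      (∀ g ∈ H, (∀ x ∈ L, g * x * g⁻¹ = x) →
        ∃ c : K, ((g : GL (Fin p) K) : Matrix (Fin p) (Fin p) K) = c • 1) :=
  PrimeDegreeClifford.exists_simple_normal_of_primitive hirrH hmono

/-- **The residual hypothesis of Theorem 1.7 with a SIMPLE layer** (sharpening of
`ght2017_adequate_or_index_p_or_psl29_of_quasisimple_odd`): the named fact follows from "(a) or
(c)" for odd `p`, `K = K̄` of characteristic `p`, finite `G` with `p ∣ |G|`, faithful irreducible
primitive `τ : G →* GL_p(K)`, and a subgroup `L ≤ τ(G)` normalised by `τ(G)`, irreducible,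
contained in `SL_p(K)` and SIMPLE as an abstract group — i.e. from GHT Theorem 2.2 (the finite
simple groups with an irreducible `p`-dimensional projective representation in characteristic `p`:
CFSG) with Props. 6.7–6.14 and Cor. 9.4–9.5; NOT in the tree.
[cite: GuralnickHerzigTiep2017, Theorem 6.15 (proof, p. 24), Proposition 6.5 (ii), Theorem 2.2] -/
theorem ght2017_adequate_or_index_p_or_psl29_of_simple_odd
    (hs : ∀ (p : ℕ) [Fact p.Prime] (K : Type u) [Field K] [IsAlgClosed K] [CharP K p]
      (G : Type v) [Group G] [Finite G] (τ : G →* GL (Fin p) K),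
      p ≠ 2 → Function.Injective τ → (glRepresentation τ).IsIrreducible →
      (∀ (b : Module.Basis (Fin p) K (Fin p → K)) (θ : ↥τ.range →* Equiv.Perm (Fin p)),
        (∀ (h : τ.range) (i : Fin p), ∃ c : K,
          ((h : GL (Fin p) K) : Matrix (Fin p) (Fin p) K) *ᵥ b i = c • b (θ h i)) →
        θ.ker ≤ Subgroup.center τ.range) →
      p ∣ Nat.card G →
      ∀ L : Subgroup (GL (Fin p) K), L ≤ τ.range → (∀ h ∈ τ.range, ∀ x ∈ L, h * x * h⁻¹ ∈ L) →
        (glRepresentation L.subtype).IsIrreducible →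
        (∀ x ∈ L, Matrix.det ((x : GL (Fin p) K) : Matrix (Fin p) (Fin p) K) = 1) →
        IsSimpleGroup L →
        Subgroup.IsExtendedAdequate τ.range ∨
          (p = 3 ∧ Nonempty (↥(τ.range.map (QuotientGroup.mk' (Subgroup.center (GL (Fin p) K)))) ≃*
            ↥(alternatingGroup (Fin 6))))) :
    ght2017_adequate_or_index_p_or_psl29.{u, v} := by
  refine ght2017_adequate_or_index_p_or_psl29_of_primitive_odd
    fun p _ K _ _ _ G _ _ τ hp hinj hirr hmono => ?_
  haveI : Finite τ.range := Finite.of_surjective _ τ.rangeRestrict_surjective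
  by_cases hdiv : p ∣ Nat.card G
  · obtain ⟨L, hLH, hLnorm, hirrL, -, hsimple, hdet, -⟩ :=
      Subgroup.exists_simple_normal_of_primitive (isIrreducible_range_subtype τ hirr) hmono
    rcases hs p K G τ hp hinj hirr hmono hdiv L hLH hLnorm hirrL hdet hsimple with h | h
    · exact Or.inl h
    · exact Or.inr (Or.inr h)
  · left
    have hp0 : 0 < p := (Fact.out : p.Prime).pos
    haveI : Representation.IsIrreducible ((glStdRepresentation (Fin p) K).comp τ) := hirr
    have hspan := Literature.RepresentationTheory.Semisimple.span_eq_top_of_isIrreducible τ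
    exact isExtendedAdequate_range_of_not_dvd_card τ hdiv
      ((Literature.RepresentationTheory.Semisimple.span_eq_top_iff_forall_isIrreducible hp0 τ).1
        hspan)

end Layer

/-! ## Theorem 6.15 (b): an abelian normal subgroup of index `p` is the kernel of a line structure

`exists_lines_of_comm_normal_index` — the parenthetical of GHT Thm 6.15 (b) ("and `G` permutes `p`
one-dimensional summands of `V` with kernel `A`"), by `PrimeDegreeClifford.clifford`. -/

section AbelianIndexP

/-- **GHT Theorem 6.15 (b), the parenthetical "and `G` permutes `p` one-dimensional summands of `V`
with kernel `A`".**  Let `K = K̄`, `G` finite, `τ : G →* GL_p(K)` faithful and irreducible, and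
`A ⊴ G` abelian of index `p`.  Then `τ(G)` permutes the lines of a basis `b` of `Kᵖ` through some
`θ : τ(G) → S_p` whose kernel is exactly `τ(A)`.  (Clifford for `τ(A) ⊴ τ(G)`: `τ(A)` is not
irreducible — abelian in prime degree — and not scalar — else `τ(G)/Z` would be cyclic of order
`p` and `τ(G)` abelian — so it acts diagonally, with pairwise distinct characters, on a basis whose
lines `τ(G)` permutes; the kernel contains `τ(A)`, has index `≥ 2` as the permutation group is
transitive, and `[τ(G) : τ(A)] = p`.) [cite: GuralnickHerzigTiep2017, Theorem 6.15 (b)] -/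
theorem exists_lines_of_comm_normal_index {K : Type u} [Field K] [IsAlgClosed K]
    {p : ℕ} [hp : Fact p.Prime] {G : Type v} [Group G] [Finite G]
    (τ : G →* GL (Fin p) K) (hinj : Function.Injective τ)
    (hirr : (glRepresentation τ).IsIrreducible)
    {A : Subgroup G} (hAn : A.Normal) (hAcomm : ∀ x ∈ A, ∀ y ∈ A, x * y = y * x)
    (hAidx : A.index = p) :
    ∃ (b : Module.Basis (Fin p) K (Fin p → K)) (θ : ↥τ.range →* Equiv.Perm (Fin p)),
      (∀ (h : τ.range) (i : Fin p), ∃ c : K,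
        ((h : GL (Fin p) K) : Matrix (Fin p) (Fin p) K) *ᵥ b i = c • b (θ h i)) ∧
      θ.ker = (A.map τ).subgroupOf τ.range := by
  classical
  haveI : Finite τ.range := Finite.of_surjective _ τ.rangeRestrict_surjective
  have hirrH := isIrreducible_range_subtype τ hirr
  have hNH : A.map τ ≤ τ.range := Subgroup.map_le_range τ A
  have hNnorm : ∀ h ∈ τ.range, ∀ x ∈ A.map τ, h * x * h⁻¹ ∈ A.map τ := by
    rintro _ ⟨g, rfl⟩ _ ⟨a, ha, rfl⟩
    exact ⟨g * a * g⁻¹, hAn.conj_mem a ha g, by rw [map_mul, map_mul, map_inv]⟩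
  have hNcomm : ∀ x ∈ A.map τ, ∀ y ∈ A.map τ, x * y = y * x := by
    rintro _ ⟨a, ha, rfl⟩ _ ⟨a', ha', rfl⟩
    rw [← map_mul, hAcomm a ha a' ha', map_mul]
  -- `τ(A)` inside `τ(G)`, of index `p`
  let N' : Subgroup τ.range := (A.map τ).subgroupOf τ.range
  have hN'idx : N'.index = p := by
    have h1 : N'.comap τ.rangeRestrict = A := by
      ext x
      simp only [N', Subgroup.mem_comap, Subgroup.mem_subgroupOf, MonoidHom.coe_rangeRestrict,
        Subgroup.mem_map]
      constructor
      · rintro ⟨a, ha, hax⟩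
        exact hinj hax ▸ ha
      · intro hx
        exact ⟨x, hx, rfl⟩
    rw [← Subgroup.index_comap_of_surjective N' τ.rangeRestrict_surjective, h1]
    exact hAidx
  haveI hN'n : N'.Normal := ⟨fun x hx g => by
    simp only [N', Subgroup.mem_subgroupOf, Subgroup.coe_mul, Subgroup.coe_inv] at hx ⊢
    exact hNnorm _ g.2 _ hx⟩
  rcases PrimeDegreeClifford.clifford hirrH hNnorm with hirrN | hsc | ⟨b, χ, hperm, hdiag, hdist⟩
  · exact (PrimeDegreeClifford.not_isIrreducible_of_comm hNcomm hirrN).elim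
  · -- scalar: `τ(G)/τ(A)` cyclic of order `p` with `τ(A)` central makes `τ(G)` abelian
    exfalso
    have hN'le : N' ≤ Subgroup.center τ.range := by
      intro x hx
      rw [Subgroup.mem_subgroupOf] at hx
      rw [Subgroup.mem_center_iff]
      intro y
      exact Subtype.ext (PrimeDegreeClifford.mul_comm_of_scalar (hsc _ hx) _).symm
    haveI : IsCyclic (τ.range ⧸ N') :=
      isCyclic_of_prime_card (p := p) (by rw [← Subgroup.index_eq_card]; exact hN'idx)
    have hcommH : ∀ x ∈ τ.range, ∀ y ∈ τ.range, x * y = y * x := by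
      intro x hx y hy
      have h := (MonoidHom.isMulCommutative_of_isCyclic_of_ker_le_center (QuotientGroup.mk' N')
        (by rw [QuotientGroup.ker_mk']; exact hN'le)).is_comm.comm ⟨x, hx⟩ ⟨y, hy⟩
      exact congrArg Subtype.val h
    exact PrimeDegreeClifford.not_isIrreducible_of_comm hcommH hirrH
  · -- lines
    obtain ⟨θ, hθ⟩ :=
      MonomialAdequacy.exists_permHom_of_lines (H := τ.range) b fun h i => hperm h h.2 i
    refine ⟨b, θ, hθ, ?_⟩
    -- `τ(A) ≤ ker θ`
    have hle : N' ≤ θ.ker := by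
      intro x hx
      rw [Subgroup.mem_subgroupOf] at hx
      exact PrimeDegreeClifford.perm_eq_one_of_diag b θ hθ x fun i => ⟨χ x i, hdiag _ hx i⟩
    -- the kernel is proper: `θ(τ(G))` is transitive on `p ≥ 2` points
    have hker_ne : θ.ker ≠ ⊤ := by
      intro htop
      choose c hc using hθ
      obtain ⟨h, hh⟩ := MonomialAdequacy.monomial_transitive b θ c hc hirrH
        ⟨0, hp.out.pos⟩ ⟨1, hp.out.one_lt⟩
      have h1 : θ h = 1 := (MonoidHom.mem_ker).1 (htop ▸ Subgroup.mem_top h)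
      rw [h1, Equiv.Perm.coe_one, id] at hh
      exact absurd (congrArg Fin.val hh) (by simp)
    -- compare indices: `[τ(G) : ker θ]` divides `[τ(G) : τ(A)] = p` and is not `1`
    symm
    refine Subgroup.eq_of_le_of_card_ge hle ?_
    have hdvd : θ.ker.index ∣ p := by
      have h := Subgroup.index_dvd_of_le hle
      rwa [hN'idx] at h
    have hidx : θ.ker.index = p := by
      rcases (Nat.dvd_prime hp.out).1 hdvd with h1 | h2
      · exact absurd (Subgroup.index_eq_one.1 h1) hker_ne
      · exact h2
    have hmul₁ := N'.card_mul_index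
    have hmul₂ := θ.ker.card_mul_index
    rw [hN'idx] at hmul₁
    rw [hidx] at hmul₂
    have : Nat.card N' * p = Nat.card θ.ker * p := hmul₁.trans hmul₂.symm
    exact (Nat.eq_of_mul_eq_mul_right hp.out.pos this).symm.le

end AbelianIndexP

/-! ## The layer is the socle: `H/Z(H) ≤ Aut(L)`; and "(b) excludes (c)" in Theorem 1.7

`Subgroup.exists_simple_socle_of_primitive` — every `H`-normalised subgroup of `H` is scalar or
contains the simple layer `L`, and conjugation `φ : H → Aut(L)` has kernel the scalars of `H`
(GHT Prop. 6.5 (ii): "`S ⊲ G/Z(G) ≤ Aut(S)`").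
`not_nonempty_mulEquiv_alternatingGroup_of_comm_normal_index` — alternatives (b) and (c) of
Theorem 1.7 are incompatible (`A₆` is simple and non-abelian). -/

section Socle

/-- **"`G` is almost quasisimple: `S ⊲ G/Z(G) ≤ Aut(S)`" (GHT Prop. 6.5 (ii)), classification-free
and with all the structure maps.**  For `K = K̄` of characteristic `p` and a finite irreducible
`H ≤ GL_p(K)` all of whose line-permutation structures have central kernel, the simple layer
`L ≤ H ∩ SL_p(K)` of `Subgroup.exists_simple_normal_of_primitive` is the SOCLE of `H` modulo
scalars: every `H`-normalised subgroup of `H` is scalar or contains `L`; and conjugation is a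
homomorphism `φ : H → Aut(L)` whose kernel is exactly the group of scalars of `H` (`= Z(H)` by
Schur), i.e. `H/Z(H) ↪ Aut(L)` with `L ≅ Inn(L) ≤ φ(H)`.
[cite: GuralnickHerzigTiep2017, Proposition 6.5 (ii)] -/
theorem Subgroup.exists_simple_socle_of_primitive {K : Type u} [Field K] [IsAlgClosed K]
    {p : ℕ} [Fact p.Prime] [CharP K p] {H : Subgroup (GL (Fin p) K)} [Finite H]
    (hirrH : (glRepresentation H.subtype).IsIrreducible)
    (hmono : ∀ (b : Module.Basis (Fin p) K (Fin p → K)) (θ : ↥H →* Equiv.Perm (Fin p)),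
      (∀ (h : H) (i : Fin p), ∃ c : K,
        ((h : GL (Fin p) K) : Matrix (Fin p) (Fin p) K) *ᵥ b i = c • b (θ h i)) →
      θ.ker ≤ Subgroup.center H) :
    ∃ L : Subgroup (GL (Fin p) K), L ≤ H ∧ (∀ h ∈ H, ∀ x ∈ L, h * x * h⁻¹ ∈ L) ∧
      (glRepresentation L.subtype).IsIrreducible ∧ IsSimpleGroup L ∧
      (∀ x ∈ L, Matrix.det ((x : GL (Fin p) K) : Matrix (Fin p) (Fin p) K) = 1) ∧
      (∀ N : Subgroup (GL (Fin p) K), N ≤ H → (∀ h ∈ H, ∀ x ∈ N, h * x * h⁻¹ ∈ N) →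
        (∀ x ∈ N, ∃ c : K, ((x : GL (Fin p) K) : Matrix (Fin p) (Fin p) K) = c • 1) ∨ L ≤ N) ∧
      ∃ φ : ↥H →* MulAut ↥L,
        (∀ (h : H) (x : L), ((φ h x : L) : GL (Fin p) K) = h * x * h⁻¹) ∧
        (∀ h : H, φ h = 1 ↔ ∃ c : K, ((h : GL (Fin p) K) : Matrix (Fin p) (Fin p) K) = c • 1) := by
  obtain ⟨L, hLH, hLnorm, hirrL, -, hsimple, hdet, hcent⟩ :=
    Subgroup.exists_simple_normal_of_primitive hirrH hmono
  have hLnorm' : ∀ h ∈ H, ∀ x ∈ L, h⁻¹ * x * h ∈ L := fun h hh x hx => by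
    simpa only [inv_inv] using hLnorm h⁻¹ (H.inv_mem hh) x hx
  -- conjugation by `h ∈ H` as an automorphism of `L`
  let e : H → MulAut L := fun h =>
    { toFun := fun x => ⟨(h : GL (Fin p) K) * x * (h : GL (Fin p) K)⁻¹, hLnorm _ h.2 _ x.2⟩
      invFun := fun x => ⟨(h : GL (Fin p) K)⁻¹ * x * (h : GL (Fin p) K), hLnorm' _ h.2 _ x.2⟩
      left_inv := fun x => Subtype.ext (by simp only; group)
      right_inv := fun x => Subtype.ext (by simp only; group)
      map_mul' := fun x y => Subtype.ext (by simp only [Subgroup.coe_mul]; group) }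
  have he : ∀ (h : H) (x : L), ((e h x : L) : GL (Fin p) K) = h * x * h⁻¹ := fun h x => rfl
  let φ : ↥H →* MulAut ↥L :=
    { toFun := e
      map_one' := by
        refine MulEquiv.ext fun x => Subtype.ext ?_
        simp only [he, MulAut.one_apply, Subgroup.coe_one, inv_one, one_mul, mul_one]
      map_mul' := fun g h => by
        refine MulEquiv.ext fun x => Subtype.ext ?_
        simp only [MulAut.mul_apply, he, Subgroup.coe_mul, InvMemClass.coe_inv, mul_inv_rev]
        group }
  have hφ : ∀ (h : H) (x : L), ((φ h x : L) : GL (Fin p) K) = h * x * h⁻¹ := fun h x => rfl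
  refine ⟨L, hLH, hLnorm, hirrL, hsimple, hdet, fun N hNH hNnorm => ?_, φ, hφ, fun h => ?_⟩
  · -- socle: `N ∩ L` is normal in the simple group `L`
    haveI := hsimple
    let M : Subgroup L := (N ⊓ L).subgroupOf L
    haveI hMn : M.Normal := ⟨fun x hx y => by
      simp only [M, Subgroup.mem_subgroupOf, Subgroup.mem_inf, Subgroup.coe_mul,
        Subgroup.coe_inv] at hx ⊢
      exact ⟨hNnorm _ (hLH y.2) _ hx.1, L.mul_mem (L.mul_mem y.2 hx.2) (L.inv_mem y.2)⟩⟩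
    rcases IsSimpleGroup.eq_bot_or_eq_top_of_normal M hMn with h0 | h1
    · -- `N ∩ L = 1`: `N` centralises `L`, hence is scalar
      left
      intro n hn
      refine hcent n (hNH hn) fun x hx => ?_
      have hcm : n * x * n⁻¹ * x⁻¹ ∈ N ⊓ L := by
        refine Subgroup.mem_inf.2 ⟨?_, ?_⟩
        · have h2 : x * n⁻¹ * x⁻¹ ∈ N := hNnorm x (hLH hx) _ (N.inv_mem hn)
          have e1 : n * x * n⁻¹ * x⁻¹ = n * (x * n⁻¹ * x⁻¹) := by group
          rw [e1]
          exact N.mul_mem hn h2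
        · exact L.mul_mem (hLnorm n (hNH hn) x hx) (L.inv_mem hx)
      have hmem : (⟨n * x * n⁻¹ * x⁻¹, (Subgroup.mem_inf.1 hcm).2⟩ : L) ∈ M := by
        rw [Subgroup.mem_subgroupOf]
        exact hcm
      rw [h0, Subgroup.mem_bot] at hmem
      have e2 : n * x * n⁻¹ * x⁻¹ = 1 := congrArg Subtype.val hmem
      calc n * x * n⁻¹ = n * x * n⁻¹ * x⁻¹ * x := by group
        _ = x := by rw [e2, one_mul]
    · -- `N ∩ L = L`
      right
      intro x hx
      have hmem : (⟨x, hx⟩ : L) ∈ M := h1 ▸ Subgroup.mem_top _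
      rw [Subgroup.mem_subgroupOf] at hmem
      exact (Subgroup.mem_inf.1 hmem).1
  · -- kernel of `φ`: the scalars
    constructor
    · intro h1
      refine hcent h h.2 fun x hx => ?_
      have e1 := congrArg (fun f : MulAut L => ((f ⟨x, hx⟩ : L) : GL (Fin p) K)) h1
      simpa only [hφ, MulAut.one_apply, InvMemClass.coe_inv] using e1
    · intro hsc
      refine MulEquiv.ext fun x => Subtype.ext ?_
      rw [hφ, MulAut.one_apply, InvMemClass.coe_inv,
        PrimeDegreeClifford.mul_comm_of_scalar hsc (x : GL (Fin p) K), mul_assoc, mul_inv_cancel,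
        mul_one]

end Socle

section ExclusivityBC

/-- `A₆` is not commutative. [folklore] -/
theorem alternatingGroup_six_not_comm :
    ¬ ∀ x y : alternatingGroup (Fin 6), x * y = y * x := by
  intro h
  have hm1 : Equiv.swap (0 : Fin 6) 1 * Equiv.swap 1 2 ∈ alternatingGroup (Fin 6) := by
    rw [Equiv.Perm.mem_alternatingGroup]; decide
  have hm2 : Equiv.swap (1 : Fin 6) 2 * Equiv.swap 2 3 ∈ alternatingGroup (Fin 6) := by
    rw [Equiv.Perm.mem_alternatingGroup]; decide
  have h1 := congrArg Subtype.val (h ⟨_, hm1⟩ ⟨_, hm2⟩)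
  simp only [Subgroup.coe_mul] at h1
  exact absurd h1 (by decide)

/-- **"(b) excludes (c)" in GHT Theorem 1.7.**  If `G` has an abelian normal subgroup `A` of index
`p` then the image of `G` in `PGL_p(k)` is not isomorphic to `PSL₂(9) ≅ A₆`: the image of `A` would
be a normal subgroup of the simple group `A₆`, hence everything (but `A₆` is not abelian) or
trivial (but then the image, a quotient of `G/A`, has at most `p < 360` elements).
[cite: GuralnickHerzigTiep2017, Theorem 1.7 ("precisely one of the following holds")] -/
theorem not_nonempty_mulEquiv_alternatingGroup_of_comm_normal_index {k : Type u} [Field k]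
    {p : ℕ} [hp : Fact p.Prime] {G : Type v} [Group G] (σ : G →* GL (Fin p) k)
    {A : Subgroup G} (hAn : A.Normal) (hAcomm : ∀ x ∈ A, ∀ y ∈ A, x * y = y * x)
    (hAidx : A.index = p) :
    ¬ Nonempty (↥(σ.range.map (QuotientGroup.mk' (Subgroup.center (GL (Fin p) k)))) ≃*
      ↥(alternatingGroup (Fin 6))) := by
  classical
  rintro ⟨e⟩
  -- the projective image as the range of `π = mk' ∘ σ`
  let π : G →* GL (Fin p) k ⧸ Subgroup.center (GL (Fin p) k) :=
    (QuotientGroup.mk' (Subgroup.center (GL (Fin p) k))).comp σ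
  have hrange : σ.range.map (QuotientGroup.mk' (Subgroup.center (GL (Fin p) k))) = π.range :=
    (MonoidHom.range_comp _ _).symm
  haveI hsimple : IsSimpleGroup (alternatingGroup (Fin 6)) :=
    alternatingGroup.isSimpleGroup (by simp)
  -- the image of `A` in `A₆`
  let f : G →* alternatingGroup (Fin 6) :=
    e.toMonoidHom.comp ((MulEquiv.subgroupCongr hrange).symm.toMonoidHom.comp π.rangeRestrict)
  have hf : Function.Surjective f := by
    refine e.surjective.comp ?_
    exact (MulEquiv.subgroupCongr hrange).symm.surjective.comp π.rangeRestrict_surjective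
  let B : Subgroup (alternatingGroup (Fin 6)) := A.map f
  haveI hBn : B.Normal := hAn.map f hf
  rcases IsSimpleGroup.eq_bot_or_eq_top_of_normal B hBn with h0 | h1
  · -- `f(A) = 1`: `A₆` is a quotient of `G/A`, so its order divides `p`: cyclic or trivial
    have hker : A ≤ f.ker := fun a ha => by
      rw [MonoidHom.mem_ker]
      have : f a ∈ B := ⟨a, ha, rfl⟩
      rwa [h0, Subgroup.mem_bot] at this
    have h1 : f.ker.index = Nat.card (alternatingGroup (Fin 6)) := by
      rw [Subgroup.index_eq_card,
        Nat.card_congr (QuotientGroup.quotientKerEquivOfSurjective f hf).toEquiv]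
    have hcard : Nat.card (alternatingGroup (Fin 6)) ∣ p := by
      have h2 := Subgroup.index_dvd_of_le hker
      rwa [hAidx, h1] at h2
    apply alternatingGroup_six_not_comm
    rcases (Nat.dvd_prime hp.out).1 hcard with h1' | h2'
    · haveI : Subsingleton (alternatingGroup (Fin 6)) := (Nat.card_eq_one_iff_unique.1 h1').1
      exact fun x y => Subsingleton.elim _ _
    · haveI : Fact p.Prime := hp
      haveI : IsCyclic (alternatingGroup (Fin 6)) := isCyclic_of_prime_card (p := p) h2'
      letI := IsCyclic.commGroup (α := alternatingGroup (Fin 6))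
      exact fun x y => mul_comm x y
  · -- `f(A) = A₆`: `A₆` would be abelian
    apply alternatingGroup_six_not_comm
    intro x y
    have hx : x ∈ B := h1 ▸ Subgroup.mem_top x
    have hy : y ∈ B := h1 ▸ Subgroup.mem_top y
    obtain ⟨a, ha, rfl⟩ := hx
    obtain ⟨a', ha', rfl⟩ := hy
    rw [← map_mul, hAcomm a ha a' ha', map_mul]

end ExclusivityBC

/-! ## The order of an irreducible group of degree `p` is divisible by `p`; Theorem 2.2's input

An elementary complement to Proposition 6.5 (ii): for `K = K̄` of characteristic `p`, every
finite irreducible `H ≤ GL_n(K)` with `p ∣ n` has order divisible by `p` — for any matrix `X`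
the average `Σ_{h ∈ H} h⁻¹ X h` commutes with `H`, hence is a scalar `c · 1` (Schur) of trace
`n c = 0`, while its trace is `|H| · tr X`; take `X = E₁₁`.  So the simple layer `L` of a
primitive group of prime degree `p` has `p ∣ |L|` with no classification input, and the residual
hypothesis of Theorem 1.7 becomes word for word the input of GHT Theorem 2.2 ("`H` quasisimple of
order divisible by `p`, `W` faithful absolutely irreducible of dimension `p ≤ d ≤ 2p`", `d = p`):
`ght2017_adequate_or_index_p_or_psl29_of_simple_layer`. -/

namespace PrimeDegreeClifford

variable {K : Type u} [Field K]

section CharDvdCard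

variable {n : ℕ}

/-- **Averaging.** For a finite `H ≤ GL_n(K)` and any matrix `X`, the sum `Σ_{h ∈ H} h⁻¹ X h`
commutes with every element of `H` (reindex the sum by right multiplication). [folklore] -/
theorem mul_sum_conj_eq_sum_conj_mul {H : Subgroup (GL (Fin n) K)} [Fintype H]
    (X : Matrix (Fin n) (Fin n) K) {g : GL (Fin n) K} (hg : g ∈ H) :
    (g : Matrix (Fin n) (Fin n) K) *
        ∑ h : H, (((h : GL (Fin n) K)⁻¹ : GL (Fin n) K) : Matrix (Fin n) (Fin n) K) * X *
          ((h : GL (Fin n) K) : Matrix (Fin n) (Fin n) K) =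
      (∑ h : H, (((h : GL (Fin n) K)⁻¹ : GL (Fin n) K) : Matrix (Fin n) (Fin n) K) * X *
          ((h : GL (Fin n) K) : Matrix (Fin n) (Fin n) K)) * g := by
  set S : Matrix (Fin n) (Fin n) K :=
    ∑ h : H, (((h : GL (Fin n) K)⁻¹ : GL (Fin n) K) : Matrix (Fin n) (Fin n) K) * X *
      ((h : GL (Fin n) K) : Matrix (Fin n) (Fin n) K) with hS
  set g' : H := ⟨g, hg⟩ with hg'
  -- reindexing `h ↦ h g'`
  have hre : ∑ h : H, ((((h * g' : H) : GL (Fin n) K)⁻¹ : GL (Fin n) K) :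
      Matrix (Fin n) (Fin n) K) * X * (((h * g' : H) : GL (Fin n) K) : Matrix (Fin n) (Fin n) K)
      = S :=
    Fintype.sum_equiv (Equiv.mulRight g') _
      (fun h : H => (((h : GL (Fin n) K)⁻¹ : GL (Fin n) K) : Matrix (Fin n) (Fin n) K) * X *
        ((h : GL (Fin n) K) : Matrix (Fin n) (Fin n) K))
      fun _ => rfl
  -- each reindexed summand is `g⁻¹ (h⁻¹ X h) g`
  have hterm : ∀ h : H, ((((h * g' : H) : GL (Fin n) K)⁻¹ : GL (Fin n) K) :
      Matrix (Fin n) (Fin n) K) * X * (((h * g' : H) : GL (Fin n) K) : Matrix (Fin n) (Fin n) K) =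
      ((g⁻¹ : GL (Fin n) K) : Matrix (Fin n) (Fin n) K) *
        ((((h : GL (Fin n) K)⁻¹ : GL (Fin n) K) : Matrix (Fin n) (Fin n) K) * X *
          ((h : GL (Fin n) K) : Matrix (Fin n) (Fin n) K)) * g := by
    intro h
    have h1 : (((h * g' : H) : GL (Fin n) K) : Matrix (Fin n) (Fin n) K) =
        ((h : GL (Fin n) K) : Matrix (Fin n) (Fin n) K) * g := by
      simp [hg', Units.val_mul]
    have h2 : ((((h * g' : H) : GL (Fin n) K)⁻¹ : GL (Fin n) K) : Matrix (Fin n) (Fin n) K) =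
        ((g⁻¹ : GL (Fin n) K) : Matrix (Fin n) (Fin n) K) *
          (((h : GL (Fin n) K)⁻¹ : GL (Fin n) K) : Matrix (Fin n) (Fin n) K) := by
      simp [hg', mul_inv_rev, Units.val_mul]
    rw [h1, h2]
    simp only [Matrix.mul_assoc]
  have hsum : ∑ h : H, ((((h * g' : H) : GL (Fin n) K)⁻¹ : GL (Fin n) K) :
      Matrix (Fin n) (Fin n) K) * X * (((h * g' : H) : GL (Fin n) K) : Matrix (Fin n) (Fin n) K) =
      ((g⁻¹ : GL (Fin n) K) : Matrix (Fin n) (Fin n) K) * S * g := by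
    simp_rw [hterm]
    rw [← Finset.sum_mul, ← Finset.mul_sum]
  have hkey : ((g⁻¹ : GL (Fin n) K) : Matrix (Fin n) (Fin n) K) * S * g = S := hsum ▸ hre
  have hgg : ((g : GL (Fin n) K) : Matrix (Fin n) (Fin n) K) * ((g⁻¹ : GL (Fin n) K) :
      Matrix (Fin n) (Fin n) K) = 1 := by
    rw [← Units.val_mul, mul_inv_cancel, Units.val_one]
  calc (g : Matrix (Fin n) (Fin n) K) * S
      = (g : Matrix (Fin n) (Fin n) K) * (((g⁻¹ : GL (Fin n) K) : Matrix (Fin n) (Fin n) K) *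
          S * g) := by rw [hkey]
    _ = ((g : Matrix (Fin n) (Fin n) K) * ((g⁻¹ : GL (Fin n) K) : Matrix (Fin n) (Fin n) K)) *
          S * g := by simp only [Matrix.mul_assoc]
    _ = S * g := by rw [hgg, Matrix.one_mul]

/-- The trace of the average `Σ_{h ∈ H} h⁻¹ X h` is `|H| · tr X`. [folklore] -/
theorem trace_sum_conj {H : Subgroup (GL (Fin n) K)} [Fintype H] (X : Matrix (Fin n) (Fin n) K) :
    Matrix.trace (∑ h : H, (((h : GL (Fin n) K)⁻¹ : GL (Fin n) K) : Matrix (Fin n) (Fin n) K) *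
      X * ((h : GL (Fin n) K) : Matrix (Fin n) (Fin n) K)) =
      (Fintype.card H : K) * Matrix.trace X := by
  rw [Matrix.trace_sum]
  have : ∀ h : H, Matrix.trace ((((h : GL (Fin n) K)⁻¹ : GL (Fin n) K) :
      Matrix (Fin n) (Fin n) K) * X * ((h : GL (Fin n) K) : Matrix (Fin n) (Fin n) K)) =
      Matrix.trace X := by
    intro h
    rw [Matrix.trace_mul_cycle, ← Units.val_mul, mul_inv_cancel, Units.val_one, Matrix.one_mul]
  simp_rw [this]
  rw [Finset.sum_const, Finset.card_univ, nsmul_eq_mul]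

/-- **`char K ∣ n ⇒ char K ∣ |H|` for an irreducible `H ≤ GL_n(K̄)`.**  If `n = 0` in `K` then
`|H| = 0` in `K`: the average `Σ_h h⁻¹ E₁₁ h` commutes with `H`, so is a scalar `c · 1` (Schur),
of trace `n c = 0`; but its trace is `|H| · tr E₁₁ = |H|`.  (Compare GHT Proposition 6.5 (ii):
"`H := G^(∞)` is quasisimple of order divisible by `p`".) [folklore] -/
theorem cast_card_eq_zero_of_isIrreducible [IsAlgClosed K] {H : Subgroup (GL (Fin n) K)} [Fintype H]
    (hirr : (glRepresentation H.subtype).IsIrreducible) (hn : (n : K) = 0) :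
    (Fintype.card H : K) = 0 := by
  have hn0 := pos_of_isIrreducible hirr
  set X : Matrix (Fin n) (Fin n) K := Matrix.single (⟨0, hn0⟩ : Fin n) (⟨0, hn0⟩ : Fin n) (1 : K)
    with hX
  set S : Matrix (Fin n) (Fin n) K :=
    ∑ h : H, (((h : GL (Fin n) K)⁻¹ : GL (Fin n) K) : Matrix (Fin n) (Fin n) K) * X *
      ((h : GL (Fin n) K) : Matrix (Fin n) (Fin n) K) with hS
  obtain ⟨c, hc⟩ := exists_eq_smul_one_of_forall_commute hirr (M := S)
    fun g hg => mul_sum_conj_eq_sum_conj_mul X hg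
  have htr := trace_sum_conj (H := H) X
  rw [← hS, hc, Matrix.trace_smul, Matrix.trace_one, hX, Matrix.trace_single_eq_same, mul_one,
    Fintype.card_fin, smul_eq_mul, hn, mul_zero] at htr
  exact htr.symm

/-- **An irreducible finite `H ≤ GL_p(K̄)` in characteristic `p` has order divisible by `p`.**
In particular the simple layer `L` of a primitive group of prime degree `p`
(`Subgroup.exists_simple_normal_of_primitive`) has `p ∣ |L|` — the standing hypothesis
"of order divisible by `p`" of GHT Theorem 2.2 — with no classification input. [folklore] -/
theorem dvd_card_of_isIrreducible [IsAlgClosed K] {p : ℕ} [Fact p.Prime] [CharP K p]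
    {H : Subgroup (GL (Fin p) K)} [Finite H]
    (hirr : (glRepresentation H.subtype).IsIrreducible) : p ∣ Nat.card H := by
  classical
  letI : Fintype H := Fintype.ofFinite H
  rw [Nat.card_eq_fintype_card, ← CharP.cast_eq_zero_iff K p]
  exact cast_card_eq_zero_of_isIrreducible hirr (CharP.cast_eq_zero K p)

end CharDvdCard

end PrimeDegreeClifford

section LayerOrder

/-- **An irreducible finite subgroup of `GL_p(K̄)`, `char K = p`, has order divisible by `p`**
(averaging + Schur; compare GHT Proposition 6.5 (ii)). [folklore] -/
theorem Subgroup.dvd_card_of_isIrreducible {K : Type u} [Field K] [IsAlgClosed K]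
    {p : ℕ} [Fact p.Prime] [CharP K p] {H : Subgroup (GL (Fin p) K)} [Finite H]
    (hirr : (glRepresentation H.subtype).IsIrreducible) : p ∣ Nat.card H :=
  PrimeDegreeClifford.dvd_card_of_isIrreducible hirr

/-- For a faithful irreducible `τ : G →* GL_p(K̄)` of a finite group in characteristic `p`,
`p ∣ |G|`: the hypothesis `p ∣ |G|` in the reductions `…_of_quasisimple_odd` / `…_of_simple_odd`
is automatic. [folklore] -/
theorem dvd_card_of_isIrreducible_glRepresentation {K : Type u} [Field K] [IsAlgClosed K]
    {p : ℕ} [Fact p.Prime] [CharP K p] {G : Type v} [Group G] [Finite G]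
    (τ : G →* GL (Fin p) K) (hinj : Function.Injective τ)
    (hirr : (glRepresentation τ).IsIrreducible) : p ∣ Nat.card G := by
  haveI : Finite τ.range := Finite.of_surjective _ τ.rangeRestrict_surjective
  have h := Subgroup.dvd_card_of_isIrreducible (isIrreducible_range_subtype τ hirr)
  rwa [← Nat.card_congr (MonoidHom.ofInjective hinj).toEquiv] at h

/-- **The simple layer with `p ∣ |L|`** (GHT Proposition 6.5 (ii), structural form, now
including "of order divisible by `p`"): for `K = K̄` of characteristic `p` and a finite
irreducible `H ≤ GL_p(K)` all of whose line-permutation structures have central kernel, there is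
`L ≤ H`, normalised by `H`, irreducible on `Kᵖ`, perfect, simple non-abelian, of order divisible
by `p`, contained in `SL_p(K)`, with scalar centraliser in `H`.
[cite: GuralnickHerzigTiep2017, Proposition 6.5 (ii)] -/
theorem Subgroup.exists_simple_normal_dvd_card_of_primitive {K : Type u} [Field K] [IsAlgClosed K]
    {p : ℕ} [Fact p.Prime] [CharP K p] {H : Subgroup (GL (Fin p) K)} [Finite H]
    (hirrH : (glRepresentation H.subtype).IsIrreducible)
    (hmono : ∀ (b : Module.Basis (Fin p) K (Fin p → K)) (θ : ↥H →* Equiv.Perm (Fin p)),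
      (∀ (h : H) (i : Fin p), ∃ c : K,
        ((h : GL (Fin p) K) : Matrix (Fin p) (Fin p) K) *ᵥ b i = c • b (θ h i)) →
      θ.ker ≤ Subgroup.center H) :
    ∃ L : Subgroup (GL (Fin p) K), L ≤ H ∧ (∀ h ∈ H, ∀ x ∈ L, h * x * h⁻¹ ∈ L) ∧
      (glRepresentation L.subtype).IsIrreducible ∧ ⁅L, L⁆ = L ∧ IsSimpleGroup L ∧
      p ∣ Nat.card L ∧
      (∀ x ∈ L, Matrix.det ((x : GL (Fin p) K) : Matrix (Fin p) (Fin p) K) = 1) ∧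
      (∀ g ∈ H, (∀ x ∈ L, g * x * g⁻¹ = x) →
        ∃ c : K, ((g : GL (Fin p) K) : Matrix (Fin p) (Fin p) K) = c • 1) := by
  obtain ⟨L, hLH, hnorm, hirrL, hperf, hsimple, hdet, hcent⟩ :=
    Subgroup.exists_simple_normal_of_primitive hirrH hmono
  haveI : Finite L := Finite.Set.subset (s := (H : Set (GL (Fin p) K))) hLH
  exact ⟨L, hLH, hnorm, hirrL, hperf, hsimple, Subgroup.dvd_card_of_isIrreducible hirrL, hdet,
    hcent⟩

/-- **The residual hypothesis of Theorem 1.7 = the input of GHT Theorem 2.2.**  The named fact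
follows from "(a) or (c)" for odd `p`, `K = K̄` of characteristic `p`, finite `G`, faithful
irreducible primitive `τ : G →* GL_p(K)`, and a subgroup `L ≤ τ(G)` normalised by `τ(G)` with
scalar centraliser, irreducible, contained in `SL_p(K)`, SIMPLE as an abstract group and OF ORDER
DIVISIBLE BY `p` — word for word the hypothesis of GHT Theorem 2.2 ("`H` a finite quasisimple
group of order divisible by `p`, `W` a faithful absolutely irreducible `kH`-module of dimension
`d`, `p ≤ d ≤ 2p`", here `d = p`, `Z(H) = 1`), whose conclusion (Lie type in characteristic `p`,
or Tables I–III: CFSG) together with Props. 6.7–6.14 and Cor. 9.4–9.5 is what remains; NOT in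
the tree. [cite: GuralnickHerzigTiep2017, Theorem 6.15 (proof, p. 24), Proposition 6.5 (ii),
Theorem 2.2] -/
theorem ght2017_adequate_or_index_p_or_psl29_of_simple_layer
    (hs : ∀ (p : ℕ) [Fact p.Prime] (K : Type u) [Field K] [IsAlgClosed K] [CharP K p]
      (G : Type v) [Group G] [Finite G] (τ : G →* GL (Fin p) K),
      p ≠ 2 → Function.Injective τ → (glRepresentation τ).IsIrreducible →
      (∀ (b : Module.Basis (Fin p) K (Fin p → K)) (θ : ↥τ.range →* Equiv.Perm (Fin p)),
        (∀ (h : τ.range) (i : Fin p), ∃ c : K,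
          ((h : GL (Fin p) K) : Matrix (Fin p) (Fin p) K) *ᵥ b i = c • b (θ h i)) →
        θ.ker ≤ Subgroup.center τ.range) →
      ∀ L : Subgroup (GL (Fin p) K), L ≤ τ.range → (∀ h ∈ τ.range, ∀ x ∈ L, h * x * h⁻¹ ∈ L) →
        (∀ g ∈ τ.range, (∀ x ∈ L, g * x * g⁻¹ = x) →
          ∃ c : K, ((g : GL (Fin p) K) : Matrix (Fin p) (Fin p) K) = c • 1) →
        (glRepresentation L.subtype).IsIrreducible →
        (∀ x ∈ L, Matrix.det ((x : GL (Fin p) K) : Matrix (Fin p) (Fin p) K) = 1) →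
        IsSimpleGroup L → p ∣ Nat.card L →
        Subgroup.IsExtendedAdequate τ.range ∨
          (p = 3 ∧ Nonempty (↥(τ.range.map (QuotientGroup.mk' (Subgroup.center (GL (Fin p) K)))) ≃*
            ↥(alternatingGroup (Fin 6))))) :
    ght2017_adequate_or_index_p_or_psl29.{u, v} := by
  refine ght2017_adequate_or_index_p_or_psl29_of_simple_odd
    fun p _ K _ _ _ G _ _ τ hp hinj hirr hmono _ L hLH hLnorm hirrL hdet hsimple => ?_
  haveI : Finite τ.range := Finite.of_surjective _ τ.rangeRestrict_surjective
  haveI : Finite L := Finite.Set.subset (s := (τ.range : Set (GL (Fin p) K))) hLH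
  -- the centraliser of `L` in `τ(G)` is scalar: it commutes with the irreducible `L` (Schur)
  have hcent : ∀ g ∈ τ.range, (∀ x ∈ L, g * x * g⁻¹ = x) →
      ∃ c : K, ((g : GL (Fin p) K) : Matrix (Fin p) (Fin p) K) = c • 1 := by
    intro g _ hg
    refine PrimeDegreeClifford.exists_eq_smul_one_of_forall_commute hirrL fun x hx => ?_
    have h1 : g * x = x * g := by
      calc g * x = g * x * g⁻¹ * g := by group
        _ = x * g := by rw [hg x hx]
    have h2 := congrArg (fun y : GL (Fin p) K => (y : Matrix (Fin p) (Fin p) K)) h1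
    simpa only [Units.val_mul] using h2.symm
  exact hs p K G τ hp hinj hirr hmono L hLH hLnorm hcent hirrL hdet hsimple
    (Subgroup.dvd_card_of_isIrreducible hirrL)

end LayerOrder

/-! ## Alternative (c) from inside `GL_p`: `L ≅ A₆` and `τ(G) ≤ L · Z`

If `L ≤ H ≤ L · Z(GL_p(K))` with `L` irreducible and unimodular (`K = K̄`, `char K = p`), then
`L ∩ Z(GL_p) = 1` (Schur and `cᵖ = 1 ⇒ c = 1`), so the image of `H` in `PGL_p(K)` is `≅ L`.  Hence
the residual hypothesis of Theorem 1.7 may be phrased without quotient groups: for the simple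
socle-layer `L` of the primitive `τ(G)`, EITHER `τ(G)` is adequate OR `p = 3`, `L ≅ A₆` and
`τ(G) ≤ L · Z` (`ght2017_adequate_or_index_p_or_psl29_of_socle_odd`). -/

section CentralProduct

/-- If `L ≤ H ≤ L ⊔ Z(G)` then `H` and `L` have the same image in `G/Z(G)`. [folklore] -/
theorem Subgroup.map_mk'_center_eq_of_le_sup {G : Type*} [Group G] {L H : Subgroup G}
    (hLH : L ≤ H) (hH : H ≤ L ⊔ Subgroup.center G) :
    H.map (QuotientGroup.mk' (Subgroup.center G)) =
      L.map (QuotientGroup.mk' (Subgroup.center G)) := by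
  refine le_antisymm ?_ (Subgroup.map_mono hLH)
  rintro _ ⟨h, hh, rfl⟩
  have hmem : (h : G) ∈ ((L ⊔ Subgroup.center G : Subgroup G) : Set G) := hH hh
  rw [Subgroup.mul_normal] at hmem
  obtain ⟨x, hx, z, hz, rfl⟩ := Set.mem_mul.1 hmem
  refine ⟨x, hx, ?_⟩
  have hz1 : QuotientGroup.mk' (Subgroup.center G) z = 1 := by
    rwa [← MonoidHom.mem_ker, QuotientGroup.ker_mk']
  simp only [map_mul, hz1, mul_one]

/-- If `L ∩ Z(G) = 1` and `L ≤ H ≤ L ⊔ Z(G)` then the image of `H` in `G/Z(G)` is isomorphic to `L`.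
[folklore] -/
theorem Subgroup.nonempty_map_mk'_center_mulEquiv_of_le_sup {G : Type*} [Group G]
    {L H : Subgroup G} (hLZ : L ⊓ Subgroup.center G = ⊥) (hLH : L ≤ H)
    (hH : H ≤ L ⊔ Subgroup.center G) :
    Nonempty (↥(H.map (QuotientGroup.mk' (Subgroup.center G))) ≃* ↥L) := by
  set π : ↥L →* G ⧸ Subgroup.center G := (QuotientGroup.mk' (Subgroup.center G)).comp L.subtype
    with hπ
  have hinj : Function.Injective π := by
    rw [← MonoidHom.ker_eq_bot_iff, Subgroup.eq_bot_iff_forall]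
    intro x hx
    rw [MonoidHom.mem_ker, hπ, MonoidHom.comp_apply, ← MonoidHom.mem_ker,
      QuotientGroup.ker_mk', Subgroup.coe_subtype] at hx
    have h1 : (x : G) ∈ L ⊓ Subgroup.center G := Subgroup.mem_inf.2 ⟨x.2, hx⟩
    rw [hLZ, Subgroup.mem_bot] at h1
    exact Subtype.ext h1
  have hrange : H.map (QuotientGroup.mk' (Subgroup.center G)) = π.range := by
    rw [Subgroup.map_mk'_center_eq_of_le_sup hLH hH, hπ, MonoidHom.range_comp, Subgroup.range_subtype]
  exact ⟨(MulEquiv.subgroupCongr hrange).trans (MonoidHom.ofInjective hinj).symm⟩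

end CentralProduct

section AlternativeC

/-- **Alternative (c) from inside `GL_p`.**  For an irreducible `L ≤ SL_p(K)`, `K = K̄` of
characteristic `p`, and `L ≤ H ≤ L · Z(GL_p(K))`: the image of `H` in `PGL_p(K)` is isomorphic
to `L` (a central element of `GL_p` lying in `L` commutes with the irreducible `L`, so is a
scalar of determinant `cᵖ = 1`, `c = 1`).  Hence if `L ≅ A₆ ≅ PSL₂(9)` the image of `H` in
`PGL_p(K)` is `≅ A₆` — alternative (c) of GHT Theorem 1.7 for `H = τ(G)`.
[cite: GuralnickHerzigTiep2017, Theorem 1.7 (c) and Theorem 6.15 (c)] -/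
theorem Subgroup.nonempty_map_mk'_center_mulEquiv_of_irreducible_of_det {K : Type u} [Field K]
    [IsAlgClosed K] {p : ℕ} [Fact p.Prime] [CharP K p] {L H : Subgroup (GL (Fin p) K)}
    (hirrL : (glRepresentation L.subtype).IsIrreducible)
    (hdet : ∀ x ∈ L, Matrix.det ((x : GL (Fin p) K) : Matrix (Fin p) (Fin p) K) = 1)
    (hLH : L ≤ H) (hH : H ≤ L ⊔ Subgroup.center (GL (Fin p) K)) :
    Nonempty (↥(H.map (QuotientGroup.mk' (Subgroup.center (GL (Fin p) K)))) ≃* ↥L) := by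
  refine Subgroup.nonempty_map_mk'_center_mulEquiv_of_le_sup ?_ hLH hH
  rw [Subgroup.eq_bot_iff_forall]
  intro x hx
  obtain ⟨hxL, hxZ⟩ := Subgroup.mem_inf.1 hx
  have hsc : ∃ c : K, ((x : GL (Fin p) K) : Matrix (Fin p) (Fin p) K) = c • 1 := by
    refine PrimeDegreeClifford.exists_eq_smul_one_of_forall_commute hirrL fun y _ => ?_
    have h1 : y * x = x * y := (Subgroup.mem_center_iff.1 hxZ y)
    have h2 := congrArg (fun u : GL (Fin p) K => (u : Matrix (Fin p) (Fin p) K)) h1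
    simpa only [Units.val_mul] using h2
  exact PrimeDegreeClifford.eq_one_of_scalar_of_det_eq_one hsc (hdet x hxL)

/-- **The residual hypothesis of Theorem 1.7 with alternative (c) stated inside `GL_p`.**  The
named fact follows from: for odd `p`, `K = K̄` of characteristic `p`, finite `G`, faithful
irreducible primitive `τ : G →* GL_p(K)` and `L ≤ τ(G)` normalised by `τ(G)`, the socle of `τ(G)`
modulo scalars (every `τ(G)`-normalised subgroup of `τ(G)` is scalar or contains `L`), with scalar
centraliser, irreducible, contained in `SL_p(K)`, simple, of order divisible by `p` — EITHER
`τ(G)` is adequate, OR `p = 3`,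
`L ≅ A₆ (≅ PSL₂(9))` and `τ(G) ≤ L · Z` (which is alternative (c):
`Subgroup.nonempty_map_mk'_center_mulEquiv_of_irreducible_of_det`).  This is GHT Theorem 2.2
(CFSG) with Props. 6.7–6.14 and Cor. 9.4–9.5, phrased without quotient groups; NOT in the tree.
[cite: GuralnickHerzigTiep2017, Theorem 6.15 (proof, p. 24), Proposition 6.5 (ii), Theorem 2.2] -/
theorem ght2017_adequate_or_index_p_or_psl29_of_socle_odd
    (hs : ∀ (p : ℕ) [Fact p.Prime] (K : Type u) [Field K] [IsAlgClosed K] [CharP K p]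
      (G : Type v) [Group G] [Finite G] (τ : G →* GL (Fin p) K),
      p ≠ 2 → Function.Injective τ → (glRepresentation τ).IsIrreducible →
      (∀ (b : Module.Basis (Fin p) K (Fin p → K)) (θ : ↥τ.range →* Equiv.Perm (Fin p)),
        (∀ (h : τ.range) (i : Fin p), ∃ c : K,
          ((h : GL (Fin p) K) : Matrix (Fin p) (Fin p) K) *ᵥ b i = c • b (θ h i)) →
        θ.ker ≤ Subgroup.center τ.range) →
      ∀ L : Subgroup (GL (Fin p) K), L ≤ τ.range → (∀ h ∈ τ.range, ∀ x ∈ L, h * x * h⁻¹ ∈ L) →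
        (∀ N : Subgroup (GL (Fin p) K), N ≤ τ.range → (∀ h ∈ τ.range, ∀ x ∈ N, h * x * h⁻¹ ∈ N) →
          (∀ x ∈ N, ∃ c : K, ((x : GL (Fin p) K) : Matrix (Fin p) (Fin p) K) = c • 1) ∨ L ≤ N) →
        (∀ g ∈ τ.range, (∀ x ∈ L, g * x * g⁻¹ = x) →
          ∃ c : K, ((g : GL (Fin p) K) : Matrix (Fin p) (Fin p) K) = c • 1) →
        (glRepresentation L.subtype).IsIrreducible →
        (∀ x ∈ L, Matrix.det ((x : GL (Fin p) K) : Matrix (Fin p) (Fin p) K) = 1) →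
        IsSimpleGroup L → p ∣ Nat.card L →
        Subgroup.IsExtendedAdequate τ.range ∨
          (p = 3 ∧ Nonempty (↥L ≃* ↥(alternatingGroup (Fin 6))) ∧
            τ.range ≤ L ⊔ Subgroup.center (GL (Fin p) K))) :
    ght2017_adequate_or_index_p_or_psl29.{u, v} := by
  refine ght2017_adequate_or_index_p_or_psl29_of_primitive_odd
    fun p _ K _ _ _ G _ _ τ hp hinj hirr hmono => ?_
  haveI : Finite τ.range := Finite.of_surjective _ τ.rangeRestrict_surjective
  obtain ⟨L, hLH, hLnorm, hirrL, hsimple, hdet, hsocle, φ, hφ, hker⟩ :=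
    Subgroup.exists_simple_socle_of_primitive (isIrreducible_range_subtype τ hirr) hmono
  have hcent : ∀ g ∈ τ.range, (∀ x ∈ L, g * x * g⁻¹ = x) →
      ∃ c : K, ((g : GL (Fin p) K) : Matrix (Fin p) (Fin p) K) = c • 1 := by
    intro g hg hcomm
    refine (hker ⟨g, hg⟩).1 (MulEquiv.ext fun x => Subtype.ext ?_)
    rw [hφ, MulAut.one_apply]
    exact hcomm x x.2
  haveI : Finite L := Finite.Set.subset (s := (τ.range : Set (GL (Fin p) K))) hLH
  rcases hs p K G τ hp hinj hirr hmono L hLH hLnorm hsocle hcent hirrL hdet hsimple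
    (Subgroup.dvd_card_of_isIrreducible hirrL) with h | ⟨hp3, ⟨e⟩, hle⟩
  · exact Or.inl h
  · right; right
    refine ⟨hp3, ?_⟩
    obtain ⟨e'⟩ :=
      Subgroup.nonempty_map_mk'_center_mulEquiv_of_irreducible_of_det hirrL hdet hLH hle
    exact ⟨e'.trans e⟩

end AlternativeC

end Literature.NumberTheory.GaloisRepresentations
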